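import Mathlib
import Summits.ValiantsHypothesis.ValiantsHypothesis.Theses.NewtonUnitEquations

/-!
# Disproof of `DissociatedFixedK` — findings (standing disprover `cdisprove-stmt-ValiantsHypothesis-5907`, gen 1 v1–v5; gen 2 v6)

Crux `stmt-ValiantsHypothesis-5907` =
`Summit.ValiantsHypothesis.ValiantsHypothesis.Theses.NewtonUnitEquations.DissociatedFixedK`
(route NewtonUnitEquations, rank 4):
`∀ k, ∃ C, ∀ m t (A : Fin m → Finset (Fin 2 →₀ ℕ)) (f : Fin k → Fin m → MvPolynomial (Fin 2) ℂ),
(∀ j, #A j ≤ t) → (∀ i j, supp f i j ⊆ A j) → (sum map injective on Π_j A j) →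
#extremePoints (conv (supp (Σ_i Π_j f i j))) ≤ (m t + 2) ^ C`.

## VERDICT (this seat; agrees with the route-review refuter's stamp of 2026-08-15)
**TRUE — and now PROVED IN LEAN in this file: §F `dissociatedFixedK_holds : DissociatedFixedK`
(with `C = 2k + 3`; rc 0, sorry-free, axioms {propext, Classical.choice, Quot.sound}).  A refuter may not
land a positive closing (D-0016), so the proof travels as item EVIDENCE (`CandidateProof.lean`, this
file's content) for a prover to land under `Theorems/`; see "HOW TO LAND" below.**  It resists disproof because
of the (mixed) CUBE LEMMA of §A, which is exactly what every cancellation design runs into: in the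
dissociated regime the coefficient of `X^{σ(a)}` (`σ(a) = Σ_j a_j`) in `Σ_i Π_j f_ij` is the rank-`≤ k`
tensor `T(a) = Σ_i Π_j c_ij(a_j)`, and a rank-`k` tensor cannot vanish on a whole `s`-cube minus one
corner while being alive at that corner unless `s ≤ k - 1`.

## GEN 2, CYCLE 1 (2026-08-16, v6) — status and what is new
* STATUS: the crux is a THEOREM modulo landing: two independent sorry-free Lean proofs exist (§F below,
  `dissociatedFixedK_holds`, re-checked on the farm this cycle: rc 0, 0 sorry, std axioms; and the line
  `annihilator-product-functional`'s `FullProof-…lean`), and the lead is landing the ≤ 400-line split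
  (`Theorems/NewtonUnitEquationsDissociatedFixedK{ExposedWord,Sweep,Thickness}.lean` are in the tree; stubs
  `stub_thicknessFit / stub_exposedWord / stub_cmpPatCount / stub_topTupleCount` all have verbatim closed
  proofs — drefute certificates).  Nothing resists; there are no Targets (`stuck_stubs = []`).  So this cycle
  attacks the CONSTANT instead of the statement:
* NEW §G (CHECKED, rc 0, sorry-free, std axioms; proposed to the Negative lane as `Negative/KTwoExponent.lean`):
  (i) `two_products_many_vertices` — for every `m ≥ 4`, the dissociated binomial frame `d_j = (2^j, 2^{m-1-j})`
  (`t = 2`) with the two products `Π_{j<m-1}(1 + 2X^{d_j})(1 + X^{d_{m-1}}) - Π_{j<m-1}(1 + X^{d_j})(1 + 2^{m-1}X^{d_{m-1}})`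
  has `≥ 4m - 6` Newton vertices: the rank-2 tensor `T(S) = 2^{#(S∖{m-1})} - (2^{m-1})^{[m-1∈S]}` dies EXACTLY
  at `S = ∅, univ` (bottom/top zonogon corners), which exposes all `m` singletons and all `m` co-singletons
  while the `2m - 2` side vertices survive.  One product has `≤ mt = 2m` vertices, so two products nearly
  DOUBLE the count, and `4m - 6 = kmt - 6`.  (ii) `not_dissociatedFixedKTwoExpOne` — hence the crux's inner
  statement at `k = 2` with exponent `C = 1` (`≤ mt + 2`) is FALSE (`m = 5`: `14 > 12`): `2 ≤ C(2) ≤ 7`.  For the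
  dead set `{∅, univ}` the count `4m - 6` is the exact maximum over ALL frames (thickness `≤ 1`: alive zonogon vertices
  `≤ 2m - 2`, single flips of `∅`/`univ` `≤ m + m`, the four zonogon neighbours of `∅`, `univ` counted twice).
  (iii) reusable INTEGER-FUNCTIONAL vertex certificates for binomial-pencil frames (`vertex_of_cert`,
  `card_le_vertices`, `length_le_vertices` + `ss_injective_of_card` for `decide`d instances).
* SEARCH RECORD (gen 2, exact arithmetic, scripts attached as evidence `k2_search.py`, `k2_search2.py`,
  `k2_clean.py`, `family.py`, `t3_family.py`): k = 2, t = 2, general integer designs `T(S) = Π_S a - cΠ_S b`,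
  `m ≤ 8`: max `V` found = `4m - 6` exactly (`m = 4, 5, 6` saturated: `10, 14, 18`; suggesting that `m = 5` is the least `m`
  where `C = 1` fails and that `V ≤ 4m - 6` holds for `k = t = 2`, `m ≥ 4`); t = 3 analogue (letters on a
  hyperbola, dead = zero word + all full-support words) gives `V = 5m - 6` (`m ≤ 8`).  k = 3, t = 2 (integer rank-3
  designs `Π_S a - c₁Π_S b - c₂Π_S e`, `m ≤ 7`, `kit/k3_search.py`): max `V` found = `4m - 6` AGAIN (14, 18, 22) — a third
  product bought nothing at `t = 2`.  CEILING (`kit/convex_subset.py`, exact `O(N⁴)` DP for the largest convexly independent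
  subset of ALL `2^m` subset sums = the `k → ∞` limit at `t = 2`): hyperbola frame `m = 4..7`: exactly `4m - 6` (so the §G
  design saturates its frame for EVERY `k`); hill-climbed frames: `m = 4, 5` never above `4m - 6`, but at `m = 6` a
  star-like frame `d = [(-12,-28),(-45,-30),(-30,44),(18,-2),(-17,-26),(13,7)]` has ceiling `20 > 18` (`kit/ceiling_climb.py`), so at
  `t = 2` SOME larger `k` beats `4m - 6` already at `m = 6` (as it must for large `m`: CLT-dense frames, cf. KPTT Prop. 1) — while
  `k = 2, 3` never did in any search.  In NO experiment (gen 1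
  §D, the three triage probes, the kinetic probes j009853/j010138, gen 2) did `V` exceed `k m t + 2`: the
  `C = 1` instance of the sibling crux `DissociatedUniform` survives everything tried, by a margin of `8` on
  the §G family.
* OPEN (unchanged): `DissociatedFixedKWithoutDissoc` (§B).  Gen-2 analysis of why it is out of reach cheaply:
  a refutation at fixed `k` needs `#vert` super-polynomial in `mt`, hence exponentially long convex chains in a
  sumset of `m` `t`-sets (these exist: KPTT digit grids, `t = 8`, chain `2^m`) carved by `O(1)` products through
  FIBRE sums — equivalently a constant-top-fan-in depth-4 expression `Σ^{O(1)}Π^{m}(t-sparse)` for a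
  Tavenas-type witness `Σ_y X^{y(y-1)/2}Y^y (+ far-right junk)`; the `q`-binomial theorem
  `Π_{j<n}(1 + q^j z) = Σ_y q^{y(y-1)/2}[n;y]_q z^y` shows where it breaks (Gaussian-binomial smear = the
  zonogon, `k = 1`, only `n + 1` chain vertices).  No such identity is known; finding one would refute the
  polynomial form of KPTT's §5 problems.  Left OPEN with this note.
* LOST: gen-1 kit jobs j007928 / j008655 (random thickness/bound verification, Part A of §D) were never
  attached and belong to the retired gen-1 identity; superseded by the triage panels' independent exact
  probes (j009496, j009513, j009531, j009938: > 7·10^5 hull-vertex checks, 0 violations) and by the PROOF.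

## PROOF BLUEPRINT (for the provers; all steps elementary; §A is the only algebra and is DONE here)
Write `c_ij : A_j → ℂ` for the coefficient vector of `f_ij`, `S_ij = supp c_ij`, `B_I = Π_j ∩_{i∈I} S_ij`.
1. *Coefficient formula.* `Π_j f_ij = Σ_{a ∈ Π_j A_j} (Π_j c_ij(a_j)) X^{σ(a)}` (`Finset.prod_sum`), so by
   injectivity of `σ` on `Π_j A_j`: `coeff (σ a) (Σ_i Π_j f_ij) = T(a)` and `supp ⊆ σ(Π_j A_j)`.
2. *Exposure.* An extreme point `p` of `conv P` (`P` finite ⊂ ℝ²) lies in `P`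
   (`extremePoints_convexHull_subset`) and is STRICTLY exposed: some linear `ℓ` has `ℓ q < ℓ p` for all
   `q ∈ P \ {p}` (planar; e.g. `p ∉ conv (P \ {p})` + `geometric_hahn_banach_point_compact`/finite LP).
   NO genericity of `ℓ` is needed below — ties are harmless.
3. *Thickness ≤ k-1.* Let `a*` be the grid point with `σ a* = p` (so `T a* ≠ 0`), `I = {i : a* ∈ B_i} ≠ ∅`,
   and `b ∈ B_I` the coordinatewise `≼`-maximum of `B_I` for the total preorder `q ≼ q' ↔ ℓ q ≤ ℓ q'`
   refined by ANY fixed tie-break (e.g. lex on ℕ²).  Put `J = {j : b_j ≠ a*_j}`.  Every point `ε ≠ a*` of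
   the sub-grid `Q = Π_{j∈J} {b_j, a*_j} × Π_{j∉J} {a*_j}` has `ℓ (σ ε) ≥ ℓ p` and `σ ε ≠ p`, hence
   `σ ε ∉ P`, i.e. `T ε = 0`.  In cube coordinates (`false ↦ b_j`, `true ↦ a*_j`) `T|_Q` is
   `Σ_i x_i Π_{j∈J} v_ij(ε_j)` with `x_i = Π_{j∉J} c_ij(a*_j)`, `v_ij(false) = c_ij(b_j)`,
   `v_ij(true) = c_ij(a*_j)`; it is `T a* ≠ 0` at the all-`true` corner and `0` elsewhere, and the
   trichotomy of `mixed_cube_lemma` holds: `i ∈ I` ⇒ all `v_ij(true) ≠ 0` and (as `b ∈ B_I ⊆ B_i`) all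
   `v_ij(false) ≠ 0`; `i ∉ I` ⇒ some `c_ij(a*_j) = 0`, i.e. `x_i = 0` (if that `j ∉ J`) or some
   `v_ij(true) = 0`.  Hence `|J| + 1 ≤ k` (§A `mixed_cube_lemma`).
4. *Counting.* `a*` is determined by `(I, b, the ≤ k-1 re-chosen coordinates and their values)`.
   For fixed `I`, `b = b_I(ℓ)` depends only on the `≼`-order restricted to the sets `C_{I,j} = ∩_{i∈I} S_ij`;
   as the direction of `ℓ` turns once around the circle this tuple changes only at directions
   perpendicular to some `q - q'`, `q ≠ q' ∈ C_{I,j}` (≤ `m t²` directions; or ≤ `m t` using hull edges),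
   so it takes ≤ `2 m t² + 1` values (1-parameter sweep `ℓ = (±1, λ)`, `(0, ±1)`: sign patterns of
   finitely many affine functions of `λ` are constant between consecutive roots — no topology needed).
   Candidates ≤ `2^k · (2 m t² + 1) · Σ_{s<k} C(m,s) (t-1)^s ≤ 2^k (2mt²+1)(mt+1)^{k-1} ≤ (mt+2)^{4k}`.
   Degenerate corners: `k = 0` or `t = 0 < m` ⇒ support empty; `m = 0` ⇒ support ⊆ {0}; all within bound.

## CONTENTS OF THIS FILE (everything outside `-- NEAR-MISSES` is sorry-free)
* §A  `cube_lemma_fin`, `cube_lemma`, `mixed_cube_lemma` — CHECKED (rc 0).  The load-bearing algebra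
      of step 3, in the exact shape step 3 produces (terms indexed by `Fin k`, cube `J → Bool`,
      conclusion `∃ s, (∀ i ∈ s, x i ≠ 0) ∧ card J + 1 ≤ #s`, decidability-free).
* §A' `cube_lemma_sharp_two/three` — the bound `s ≤ k-1` is attained (`k = s+1` terms realise
      `c·y₁⋯y_s`), so "thickness `k-1`" genuinely occurs: no proof can get thickness `< k-1`.
* §B0 WITNESS MACHINERY (CHECKED): `mem_extremePoints_convexHull_of_strict_sep` (strict exposure by a
      linear functional ⇒ extreme point of `conv S`; general real vector space — provers: this is the
      easy half of blueprint step 2), the convex lattice chain `chainPt n = (n(n-1)/2, n)` (KPTT Lemma 2)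
      with `extremePoints_chain` (all chain points are vertices) and `chainPoly`/`support_chainPoly`/
      `vertices_chainPoly` (a sum of distinct monomials on the chain has exactly that many vertices,
      stated with the crux's literal embedding `fun e i => ((e i : ℕ) : ℝ)`).
* §B  LOAD-BEARING ANALYSIS (CHECKED).  `DissociatedFixedKWithoutCard` / `…WithoutSupp` (drop
      `#A j ≤ t` / drop `supp f_ij ⊆ A_j`): FALSE — `t` then no longer controls the supports and the
      single polynomial `chainPoly (range (2^C+1))` (`k = m = 1`, `t = 0`) has `2^C + 1 > 2^C` vertices
      (theorems `dissociatedFixedK_false_without_card`, `dissociatedFixedK_false_without_supp`).  `DissociatedFixedKWithoutDissoc`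
      (drop injectivity of the sum map): OPEN — for `k = 1` it is true (Newton polygon of a product =
      Minkowski sum, ≤ `mt` vertices); for `k = 2` it contains a polynomial-in-`mt` form of the sibling
      crux `TwoProducts` (KPTT §5 open problems `fg+1`, `f₁⋯f_m + 1`); no counterexample known, none
      found.  So: of the three hypotheses only DISSOCIATION carries mathematical weight, and it is used
      in step 1 (coefficient = tensor value) and step 4 (tuple `b` ↦ its sum is injective is NOT needed).
* §C  NATURAL STRENGTHENING REFUTED: `DissociatedFixedKUniformC` (one `C` for all `k`) is FALSE —
      KPTT arXiv:1308.2286 Example 3 + Lemma 2 (p. 7): the digit grids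
      `A_j = {(b^{2j} i, b^j i') : i < b², i' < b}` (`t = b³`) are dissociated, their sum is the full box
      `[0,b^{2m}) × [0,b^m)`, which contains the `b^m = t^{m/3}` convexly independent points
      `(y(y-1)/2, y)`, each realised by ONE product of monomials (`k = b^m`).  With `m = 3C+3`,
      `b = (3C+5)^C + 1`: vertices `= t^{C+1} > (mt+2)^C`.  Consequently `C(k) → ∞` is forced, at rate
      `C(k) ≳ log k / log log k`; the blueprint gives `C(k) = O(k)`; closing that gap IS the sibling crux
      `DissociatedUniform` (stmt-5905), not this item.  Theorem `not_dissociatedFixedKUniformC` —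
      CHECKED (digit arithmetic `sum_pow_mul_digit`/`digits_unique`, `digitGrid_dissociated`,
      `sum_prod_digit_monomials`, `uniformC_arith`); axioms {propext, Classical.choice, Quot.sound}.
* §D  COMPUTATION (kit job j007928, `kit/dissoc_probe.py`, attached to the item): Part A — random
      cancelling instances (`t ∈ {2,3}`, `m ≤ 7`, `k ≤ 4`, coefficients in `{±1}, μ₃, μ₄, {±1,±2,½}`,
      15 % dead coefficients, forced identical cancelling pairs): 0 thickness violations, 0 bound
      violations in 1232 + 1852 instances (two local smoke runs; full run = job j008655, results to be
      appended).  Part B/C — rank-`k` zero-set designs on `{0,1}^m` (bands `{n_e(S) ∈ R}`, `|R| ≤ k-1`;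
      unions of `p` hyperplane sections, `2^p ≤ k`; residue designs over `μ_q`) with hill-climbed
      geometry: best found `V = 18, 20, 22, 24` at `m = 6, 7, 8, 9` for `k = 2` (residue designs mod 3, 4:
      `V ≈ 3m`, versus the zonogon's `2m` at `k = 1`), nothing super-linear in `m` and no visible growth
      in `k ≤ 8` at `m ≤ 6` — far below `2^k(mt+1)^k`.  The truth is plausibly `O_k(m t)`-ish
      (Davenport–Schinzel-type envelope counts); that gap is DissociatedUniform's business.
* §E  PROVER KIT (CHECKED; positive helpers, attached as evidence — a prover lands/uses them):
      §E0 `exists_strict_sep_of_mem_extremePoints_convexHull` (step 2: an extreme point of the hull of a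
      FINITE set in a normed space is strictly exposed by a continuous linear functional — Hahn–Banach
      against the compact hull of the other points); §E1 `coeff_sum_prod_of_dissociated`,
      `exists_word_of_mem_support` (step 1: under dissociation the coefficient at `Σ_j a_j` is the tensor
      value `Σ_i Π_j coeff (a j) (f i j)`, and every support exponent comes from a grid word with
      `T ≠ 0`); §E2 `ncard_range_signVec_le` (sign vectors of `|D|` affine functions of one real
      parameter take `≤ 2|D|+2` values — root counting, no topology); §E3 `ncard_range_cmpPat_le` (the
      comparison pattern of an ARBITRARY continuous linear functional on a finite `P ⊂ ℝ²` takes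
      `≤ 4|P|²+7` values); §E4 `lexTop` (the `l`-top letter with lexicographic tie-break),
      `apply_le_apply_lexTop`, `lexTop_eq_of_cmpPat_eq`, `ncard_range_topTuple_le` (step 4: for a
      fixed tuple of letter sets inside `P`, the tuple of tops takes `≤ 4|P|²+7` values as `l` varies).
      WHAT IS LEFT for the prover: the assembly — for each extreme point `p` pick `l_p` (§E0), the word
      `a*_p` (§E1), `I_p`, `b_p = topTuple l_p I_p` (§E4 with `C j = A j` filtered by aliveness of `I_p`),
      run `mixed_cube_lemma` (§A, IN TREE as `…Theorems.DissociatedFixedK.Negative.CubeLemma`) on the cube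
      between `b_p` and `a*_p` to get `#{j : a*_p j ≠ b_p j} ≤ k-1`, and count: `p ↦ a*_p` is injective
      and `a*_p` lies in the Hamming ball of radius `k-1` around some `b ∈ ⋃_I range (topTuple · I)`
      (`≤ 2^k (4(mt)²+7)` centres, ball size `≤ (mt+1)^{k-1}`), total `≤ (mt+2)^{4k+4}` say.
* §F  FULL PROOF (CHECKED): `emb_sum`, `lexTop'`, `aliveLetters`, `topTuple`, `allPts`,
      `ncard_range_topTuple_le'`, `tensorVal`, `diffCard`, `thickness_le` (step 3 on the real objects:
      every extreme point is `emb (Σ a_j)` for a grid word within Hamming distance `k-1` of the top tuple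
      of its alive stratum), `ball`/`card_ball_le` (`≤ (mt+1)^r`), `vertices_le`
      (`#vert ≤ 2^k (4(mt)²+7)(mt+1)^{k-1}`), `bound_le_pow` (`≤ (mt+2)^{2k+3}`), `dissociatedFixedK_holds`.
      HOW TO LAND (prover): Theorems files are ≤ 400 lines, so split into e.g.
      `NewtonUnitEquationsDissociatedFixedK{Coeff (§E1), Sweep (§E2–§E3), LexTop (§E0, §E4),
      Thickness (§F up to thickness_le), Proof (§F rest)}.lean`, importing the in-tree
      `…Theorems.DissociatedFixedK.Negative.CubeLemma` (for `mixed_cube_lemma`) and `….Negative.LoadBearing`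
      (for `emb`, `emb_injective`) instead of §A/§B0, each theorem with a docstring; propose in order with
      `--supports stmt-ValiantsHypothesis-5907` for the helpers and `--workitem stmt-ValiantsHypothesis-5907` for the last.
* LANDED IN TREE: `Summits/…/Theorems/DissociatedFixedK/Negative/CubeLemma.lean` (p73482, §A/§A'),
  `…/Negative/LoadBearing.lean` (p74111, §B0/§B) and `…/Negative/UniformCFalse.lean` (p76819, §C:
  `Summit.ValiantsHypothesis.ValiantsHypothesis.Theorems.DissociatedFixedK.Negative.not_dissociatedFixedKUniformC :
  ¬ Literature.Uncategorized.DissociatedFixedKUniformC`).  CAVEAT: the gate auto-relocated the refuted `def`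
  into `Literature/Uncategorized/DissociatedFixedKUniformC.lean` (p76818) because of a stray `[folklore]` tag —
  that def is a FALSE statement, not a fact; audit `audit:p76818` filed to mark/deprecate it.  Do not cite it.
* §G  (gen 2, CHECKED) `k = 2` exponent: `DissociatedFixedKTwoExpOne` (crux at `k = 2`, `C = 1`) is FALSE —
      `not_dissociatedFixedKTwoExpOne`; family `two_products_many_vertices` (`≥ 4m - 6` vertices, all `m ≥ 4`);
      binomial-pencil certificate kit (`frame/fac/tval/word`, `vertex_of_cert`, `card_le_vertices`, `length_le_vertices`).
* `-- Targets`: none (line `annihilator-product-functional` picked and fully proved; `stuck_stubs = []`).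
* `-- NEAR-MISSES`: none (nothing resisted; the verdict is "true").  This version is sorry-free.
-/


namespace Summit.ValiantsHypothesis.ValiantsHypothesis.Cruxes.DissociatedFixedK.Disproof

open Finset

/-! ## §A  The cube lemma (pure and mixed) — CHECKED -/

section CubeLemma
variable {K : Type*} [Field K] {ι : Type*} [Fintype ι] [DecidableEq ι]
/-- **Pure cube lemma** on the cube `Fin n → Bool`.  If `T(ε) = ∑ i, x i * ∏ j, v i j (ε j)` equals
`c ≠ 0` at the all-`true` corner and `0` at every other corner, and every live term (`x i ≠ 0`) has all
its `false`-entries nonzero, then at least `n + 1` terms are live.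
(Polynomial reading: `c·y₁⋯yₙ = Σ_i x_i ∏_j (p_ij + q_ij y_j)` with all `p_ij ≠ 0` needs `≥ n+1` terms.)
Proof: contract coordinate `0` against `(φ, 1)` with `φ = -q/p` of a live term; this kills that term,
keeps the shape, and drops the dimension by one. [folklore] -/
theorem cube_lemma_fin (n : ℕ) :
    ∀ (x : ι → K) (v : ι → Fin n → Bool → K) (c : K), c ≠ 0 →
      (∑ i, x i * ∏ j, v i j true) = c →
      (∀ ε : Fin n → Bool, (∃ j, ε j = false) → (∑ i, x i * ∏ j, v i j (ε j)) = 0) →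
      (∀ i, x i ≠ 0 → ∀ j, v i j false ≠ 0) →
      ∃ s : Finset ι, (∀ i ∈ s, x i ≠ 0) ∧ n + 1 ≤ s.card := by
  induction n with
  | zero =>
    intro x v c hc h1 _ _
    have hex : ∃ i₀, x i₀ * ∏ j, v i₀ j true ≠ 0 := by
      by_contra hne
      simp only [not_exists, not_not] at hne
      exact hc (by rw [← h1]; exact Finset.sum_eq_zero (fun i _ => hne i))
    obtain ⟨i₀, hi₀⟩ := hex
    exact ⟨{i₀}, by simpa using left_ne_zero_of_mul hi₀, by simp⟩
  | succ n ih =>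
    intro x v c hc h1 h0 hfull
    -- a live term with all `true`-entries nonzero exists (value `c ≠ 0` at the top corner)
    have hex : ∃ i₀, x i₀ * ∏ j, v i₀ j true ≠ 0 := by
      by_contra hne
      simp only [not_exists, not_not] at hne
      exact hc (by rw [← h1]; exact Finset.sum_eq_zero (fun i _ => hne i))
    obtain ⟨i₀, hi₀⟩ := hex
    have hx₀ : x i₀ ≠ 0 := left_ne_zero_of_mul hi₀
    have hv₀0 : v i₀ 0 false ≠ 0 := hfull i₀ hx₀ 0
    -- contract coordinate 0 with the covector (φ, 1), φ = - v i₀ 0 true / v i₀ 0 false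
    set φ : K := - v i₀ 0 true / v i₀ 0 false with hφ
    set x' : ι → K := fun i => x i * (φ * v i 0 false + v i 0 true) with hx'
    set v' : ι → Fin n → Bool → K := fun i j b => v i j.succ b with hv'
    have key : ∀ ε : Fin n → Bool,
        (∑ i, x' i * ∏ j, v' i j (ε j)) =
          φ * (∑ i, x i * ∏ j, v i j ((Fin.cons false ε : Fin (n+1) → Bool) j)) +
            (∑ i, x i * ∏ j, v i j ((Fin.cons true ε : Fin (n+1) → Bool) j)) := by
      intro ε
      simp only [hx', hv', Fin.prod_univ_succ, Fin.cons_zero, Fin.cons_succ, Finset.mul_sum,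
        ← Finset.sum_add_distrib]
      apply Finset.sum_congr rfl
      intro i _
      ring
    have h1' : (∑ i, x' i * ∏ j, v' i j true) = c := by
      rw [key (fun _ => true)]
      have hA : (∑ i, x i * ∏ j, v i j ((Fin.cons false (fun _ : Fin n => true) : Fin (n+1) → Bool) j))
          = 0 := h0 _ ⟨0, by simp⟩
      have hB : (∑ i, x i * ∏ j, v i j ((Fin.cons true (fun _ : Fin n => true) : Fin (n+1) → Bool) j))
          = c := by
        have : (Fin.cons true (fun _ : Fin n => true) : Fin (n+1) → Bool) = fun _ => true := by
          funext j
          refine Fin.cases ?_ ?_ j <;> simp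
        rw [this]; exact h1
      rw [hA, hB]; ring
    have h0' : ∀ ε : Fin n → Bool, (∃ j, ε j = false) → (∑ i, x' i * ∏ j, v' i j (ε j)) = 0 := by
      intro ε ⟨j, hj⟩
      rw [key ε]
      have hA : (∑ i, x i * ∏ j, v i j ((Fin.cons false ε : Fin (n+1) → Bool) j)) = 0 :=
        h0 _ ⟨0, by simp⟩
      have hB : (∑ i, x i * ∏ j, v i j ((Fin.cons true ε : Fin (n+1) → Bool) j)) = 0 :=
        h0 _ ⟨j.succ, by simp [hj]⟩
      rw [hA, hB]; ring
    have hfull' : ∀ i, x' i ≠ 0 → ∀ j, v' i j false ≠ 0 := by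
      intro i hi j
      exact hfull i (left_ne_zero_of_mul hi) j.succ
    obtain ⟨s', hs'live, hs'card⟩ := ih x' v' c hc h1' h0' hfull'
    have hdead : x' i₀ = 0 := by
      simp only [hx', hφ]
      field_simp
      ring
    have hi₀s' : i₀ ∉ s' := fun h => hs'live i₀ h hdead
    refine ⟨insert i₀ s', ?_, ?_⟩
    · intro i hi
      rcases Finset.mem_insert.mp hi with rfl | hi
      · exact hx₀
      · exact left_ne_zero_of_mul (hs'live i hi)
    · rw [Finset.card_insert_of_notMem hi₀s']
      omega


/-- **Pure cube lemma** on an arbitrary finite cube `J → Bool` (transport of `cube_lemma_fin` along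
`Fintype.equivFin J`). [folklore] -/
theorem cube_lemma {J : Type*} [Fintype J] [DecidableEq J]
    (x : ι → K) (v : ι → J → Bool → K) (c : K) (hc : c ≠ 0)
    (h1 : (∑ i, x i * ∏ j, v i j true) = c)
    (h0 : ∀ ε : J → Bool, (∃ j, ε j = false) → (∑ i, x i * ∏ j, v i j (ε j)) = 0)
    (hfull : ∀ i, x i ≠ 0 → ∀ j, v i j false ≠ 0) :
    ∃ s : Finset ι, (∀ i ∈ s, x i ≠ 0) ∧ Fintype.card J + 1 ≤ s.card := by
  set e := Fintype.equivFin J with he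
  set vF : ι → Fin (Fintype.card J) → Bool → K := fun i j' b => v i (e.symm j') b with hvF
  refine cube_lemma_fin (Fintype.card J) x vF c hc ?_ ?_ ?_
  · rw [← h1]
    apply Finset.sum_congr rfl
    intro i _
    simp only [hvF]
    rw [e.symm.prod_comp (fun j => v i j true)]
  · intro εF ⟨j', hj'⟩
    have hε : ∃ j, (εF ∘ e) j = false := ⟨e.symm j', by simpa using hj'⟩
    rw [← h0 (εF ∘ e) hε]
    apply Finset.sum_congr rfl
    intro i _
    simp only [hvF]
    rw [← e.symm.prod_comp (fun j => v i j ((εF ∘ e) j))]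
    simp
  · intro i hi j'
    exact hfull i hi (e.symm j')

/-- **Mixed cube lemma.**  Same conclusion when every live term EITHER has all `false`-entries nonzero
OR has some `true`-entry equal to zero (a term "dead at the bottom corner").  In the thickness
argument for `DissociatedFixedK` the first kind are the products alive at the top survivor `a*`
(then also alive at the box-top `b`), the second kind are the products dead at `a*` inside the
re-chosen coordinates; products dead at `a*` outside them have `x i = 0`.
Proof: restrict the cube to `ε_j = true` on a set `U` of chosen dead witnesses (one per dead live
term, so `|U| ≤ #dead`); this kills every dead term and leaves a pure instance on `J \ U`, whence
`#alive ≥ |J| - |U| + 1`. [folklore] -/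
theorem mixed_cube_lemma {J : Type*} [Fintype J] [DecidableEq J]
    (x : ι → K) (v : ι → J → Bool → K) (c : K) (hc : c ≠ 0)
    (h1 : (∑ i, x i * ∏ j, v i j true) = c)
    (h0 : ∀ ε : J → Bool, (∃ j, ε j = false) → (∑ i, x i * ∏ j, v i j (ε j)) = 0)
    (htri : ∀ i, x i ≠ 0 → (∀ j, v i j false ≠ 0) ∨ (∃ j, v i j true = 0)) :
    ∃ s : Finset ι, (∀ i ∈ s, x i ≠ 0) ∧ Fintype.card J + 1 ≤ s.card := by
  classical
  -- dead live terms and one witness coordinate for each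
  set D : Finset ι := univ.filter (fun i => x i ≠ 0 ∧ ∃ j, v i j true = 0) with hD
  have hDmem : ∀ i ∈ D, ∃ j, v i j true = 0 := fun i hi => (Finset.mem_filter.mp hi).2.2
  set U : Finset J := D.attach.image (fun i => (hDmem i.1 i.2).choose) with hU
  have hUspec : ∀ i (hi : i ∈ D), (hDmem i hi).choose ∈ U ∧ v i (hDmem i hi).choose true = 0 :=
    fun i hi => ⟨Finset.mem_image.mpr ⟨⟨i, hi⟩, Finset.mem_attach _ _, rfl⟩, (hDmem i hi).choose_spec⟩
  have hUcard : U.card ≤ D.card := by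
    calc U.card ≤ D.attach.card := Finset.card_image_le
      _ = D.card := Finset.card_attach
  -- restricted instance on the sub-cube `Uᶜ`
  set x' : ι → K := fun i => x i * ∏ j ∈ U, v i j true with hx'
  set v' : ι → ↥(Uᶜ) → Bool → K := fun i j b => v i j.1 b with hv'
  have hdeadkill : ∀ i ∈ D, x' i = 0 := by
    intro i hi
    obtain ⟨hmem, hzero⟩ := hUspec i hi
    simp only [hx']
    rw [Finset.prod_eq_zero hmem hzero, mul_zero]
  -- extension of a corner of the sub-cube by `true` on `U`
  let ext : (↥(Uᶜ) → Bool) → (J → Bool) :=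
    fun ε' j => if h : j ∈ U then true else ε' ⟨j, Finset.mem_compl.mpr h⟩
  have hsplit : ∀ (ε' : ↥(Uᶜ) → Bool) (i : ι),
      x' i * ∏ j, v' i j (ε' j) = x i * ∏ j, v i j (ext ε' j) := by
    intro ε' i
    simp only [hx', hv']
    have hA : ∏ j ∈ U, v i j true = ∏ j ∈ U, v i j (ext ε' j) := by
      apply Finset.prod_congr rfl
      intro j hj
      simp [ext, hj]
    have hB : (∏ j : ↥(Uᶜ), v i j.1 (ε' j)) = ∏ j ∈ Uᶜ, v i j (ext ε' j) := by
      rw [← Finset.prod_coe_sort (Uᶜ) (fun j => v i j (ext ε' j))]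
      apply Finset.prod_congr rfl
      intro j _
      have hj : (j : J) ∉ U := Finset.mem_compl.mp j.2
      simp [ext, hj]
    rw [hA, mul_assoc, hB, Finset.prod_mul_prod_compl]
  have h1' : (∑ i, x' i * ∏ j, v' i j true) = c := by
    rw [← h1]
    apply Finset.sum_congr rfl
    intro i _
    rw [show x' i * ∏ j, v' i j true = x i * ∏ j, v i j (ext (fun _ => true) j) from
      hsplit (fun _ => true) i]
    congr 1
    apply Finset.prod_congr rfl
    intro j _
    simp [ext]
  have h0' : ∀ ε' : ↥(Uᶜ) → Bool, (∃ j, ε' j = false) → (∑ i, x' i * ∏ j, v' i j (ε' j)) = 0 := by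
    intro ε' ⟨j, hj⟩
    have hjU : (j : J) ∉ U := Finset.mem_compl.mp j.2
    have hε : ∃ j₀, ext ε' j₀ = false := ⟨j.1, by simp [ext, hjU, hj]⟩
    rw [← h0 (ext ε') hε]
    apply Finset.sum_congr rfl
    intro i _
    exact hsplit ε' i
  have hfull' : ∀ i, x' i ≠ 0 → ∀ j, v' i j false ≠ 0 := by
    intro i hi j
    have hx : x i ≠ 0 := left_ne_zero_of_mul hi
    rcases htri i hx with h | h
    · exact h j.1
    · exact absurd (hdeadkill i (Finset.mem_filter.mpr ⟨Finset.mem_univ _, hx, h⟩)) hi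
  obtain ⟨s, hslive, hscard⟩ := cube_lemma x' v' c hc h1' h0' hfull'
  -- `s` (alive at the restriction) and `D` (dead) are disjoint sets of live terms
  have hdisj : Disjoint s D := by
    rw [Finset.disjoint_left]
    intro i his hiD
    exact hslive i his (hdeadkill i hiD)
  refine ⟨s ∪ D, ?_, ?_⟩
  · intro i hi
    rcases Finset.mem_union.mp hi with hi | hi
    · exact left_ne_zero_of_mul (hslive i hi)
    · exact (Finset.mem_filter.mp hi).2.1
  · rw [Finset.card_union_of_disjoint hdisj]
    have hcc : Fintype.card ↥(Uᶜ) = Fintype.card J - U.card := by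
      rw [Fintype.card_coe, Finset.card_compl]
    have hUle : U.card ≤ Fintype.card J := Finset.card_le_univ U
    omega

end CubeLemma

/-! ## §A'  Sharpness of the cube lemma (thickness `k - 1` is attained) -/

/-- `s = 1`, two terms: `y = (1 + 2y) - (1 + y)`; in cube form on `Fin 1 → Bool`. [folklore] -/
theorem cube_lemma_sharp_one :
    let x : Fin 2 → ℚ := ![1, -1]
    let v : Fin 2 → Fin 1 → Bool → ℚ := fun i _ b => if b then (![2, 1] i) else 1
    (∑ i, x i * ∏ j, v i j true) = 1 ∧
      (∀ ε : Fin 1 → Bool, (∃ j, ε j = false) → (∑ i, x i * ∏ j, v i j (ε j)) = 0) ∧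
      (∀ i, x i ≠ 0 → ∀ j, v i j false ≠ 0) := by
  refine ⟨by norm_num [Fin.sum_univ_two], ?_, ?_⟩
  · rintro ε ⟨j, hj⟩
    have : ε = fun _ => false := by
      funext j'; rw [Subsingleton.elim j' j]; exact hj
    subst this
    simp [Fin.sum_univ_two]
  · intro i _ j; simp

/-- `s = 2`, three terms (second finite difference): `2·y₁y₂ = Σ_{i=0,1,2} (-1)^i C(2,i) Π_j (1 + i·y_j)`;
in cube form on `Fin 2 → Bool` with `v i j true = i`, `v i j false = 1`, `x = (1,-2,1)`. [folklore] -/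
theorem cube_lemma_sharp_two :
    let x : Fin 3 → ℚ := fun i => (-1) ^ (i : ℕ) * (Nat.choose 2 i : ℚ)
    let v : Fin 3 → Fin 2 → Bool → ℚ := fun i _ b => if b then ((i : ℕ) : ℚ) else 1
    (∑ i, x i * ∏ j, v i j true) = 2 ∧
      (∀ ε : Fin 2 → Bool, (∃ j, ε j = false) → (∑ i, x i * ∏ j, v i j (ε j)) = 0) ∧
      (∀ i, x i ≠ 0 → ∀ j, v i j false ≠ 0) := by
  refine ⟨by norm_num [Fin.sum_univ_three], ?_, ?_⟩
  · rintro ε ⟨j, hj⟩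
    -- the three corners with a `false` coordinate
    have hcases : ε = ![false, false] ∨ ε = ![false, true] ∨ ε = ![true, false] := by
      have h0 := ε 0; have h1 := ε 1
      rcases Bool.eq_false_or_eq_true (ε 0) with h0 | h0 <;>
      rcases Bool.eq_false_or_eq_true (ε 1) with h1 | h1
      · exfalso
        fin_cases j <;> simp_all
      · right; right; funext i; fin_cases i <;> simp [h0, h1]
      · right; left; funext i; fin_cases i <;> simp [h0, h1]
      · left; funext i; fin_cases i <;> simp [h0, h1]
    rcases hcases with rfl | rfl | rfl <;> norm_num [Fin.sum_univ_three, Fin.prod_univ_two]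
  · intro i _ j; simp

/-! ## §B0  Witness machinery: strict exposure, the convex lattice chain, `chainPoly` -/

/-- Strict exposure by a linear functional makes a point of `S` an extreme point of `conv S`:
if `l y < l x` for every `y ∈ S \ {x}` then `x ∈ extremePoints (convexHull S)`.  [folklore] -/
theorem mem_extremePoints_convexHull_of_strict_sep {E : Type*} [AddCommGroup E] [Module ℝ E]
    {S : Set E} {x : E} (hx : x ∈ S) (l : E →ₗ[ℝ] ℝ) (hl : ∀ y ∈ S, y ≠ x → l y < l x) :
    x ∈ Set.extremePoints ℝ (convexHull ℝ S) := by
  -- the convex set `B = {x} ∪ {l < l x}` contains `S`, hence `conv S`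
  set B : Set E := {y | y = x ∨ l y < l x} with hB
  have hBconv : Convex ℝ B := by
    intro y₁ hy₁ y₂ hy₂ a b ha hb hab
    have hval : l (a • y₁ + b • y₂) = a * l y₁ + b * l y₂ := by
      simp [map_add, map_smul, smul_eq_mul]
    by_cases ha0 : a = 0
    · subst ha0
      simp only [zero_add] at hab
      subst hab
      simpa using hy₂
    by_cases hb0 : b = 0
    · subst hb0
      simp only [add_zero] at hab
      subst hab
      simpa using hy₁
    have hapos : 0 < a := lt_of_le_of_ne ha (Ne.symm ha0)
    have hbpos : 0 < b := lt_of_le_of_ne hb (Ne.symm hb0)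
    have h1 : l y₁ ≤ l x := by
      rcases hy₁ with h | h
      · rw [h]
      · exact h.le
    have h2 : l y₂ ≤ l x := by
      rcases hy₂ with h | h
      · rw [h]
      · exact h.le
    rcases hy₁ with rfl | hy₁
    · rcases hy₂ with rfl | hy₂
      · left
        rw [← add_smul, hab, one_smul]
      · right
        rw [hval]
        have e1 : a * l y₁ + b * l y₁ = l y₁ := by rw [← add_mul, hab, one_mul]
        have e2 : b * l y₂ < b * l y₁ := mul_lt_mul_of_pos_left hy₂ hbpos
        linarith
    · right
      rw [hval]
      have e1 : a * l x + b * l x = l x := by rw [← add_mul, hab, one_mul]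
      have e2 : a * l y₁ < a * l x := mul_lt_mul_of_pos_left hy₁ hapos
      have e3 : b * l y₂ ≤ b * l x := mul_le_mul_of_nonneg_left h2 hb
      linarith
  have hSB : S ⊆ B := by
    intro y hy
    by_cases h : y = x
    · exact Or.inl h
    · exact Or.inr (hl y hy h)
  have hconvB : convexHull ℝ S ⊆ B := convexHull_min hSB hBconv
  rw [mem_extremePoints]
  refine ⟨subset_convexHull ℝ S hx, ?_⟩
  intro x₁ hx₁ x₂ hx₂ hxseg
  obtain ⟨a, b, ha, hb, hab, hcomb⟩ := hxseg
  have key : l x = a * l x₁ + b * l x₂ := by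
    rw [← hcomb]; simp [map_add, map_smul, smul_eq_mul]
  have h1 := hconvB hx₁
  have h2 := hconvB hx₂
  have hl1 : l x₁ ≤ l x := by
    rcases h1 with h | h
    · rw [h]
    · exact h.le
  have hl2 : l x₂ ≤ l x := by
    rcases h2 with h | h
    · rw [h]
    · exact h.le
  have e1 : a * l x + b * l x = l x := by rw [← add_mul, hab, one_mul]
  constructor
  · rcases h1 with h | h
    · exact h
    · exfalso
      have e2 : a * l x₁ < a * l x := mul_lt_mul_of_pos_left h ha
      have e3 : b * l x₂ ≤ b * l x := mul_le_mul_of_nonneg_left hl2 hb.le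
      linarith
  · rcases h2 with h | h
    · exact h
    · exfalso
      have e2 : b * l x₂ < b * l x := mul_lt_mul_of_pos_left h hb
      have e3 : a * l x₁ ≤ a * l x := mul_le_mul_of_nonneg_left hl1 ha.le
      linarith

/-- If every point of `S` is strictly exposed then `extremePoints (conv S) = S`. [folklore] -/
theorem extremePoints_convexHull_eq_of_strict_sep {E : Type*} [AddCommGroup E] [Module ℝ E]
    {S : Set E} (h : ∀ x ∈ S, ∃ l : E →ₗ[ℝ] ℝ, ∀ y ∈ S, y ≠ x → l y < l x) :
    Set.extremePoints ℝ (convexHull ℝ S) = S := by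
  apply Set.Subset.antisymm extremePoints_convexHull_subset
  intro x hx
  obtain ⟨l, hl⟩ := h x hx
  exact mem_extremePoints_convexHull_of_strict_sep hx l hl

/-- The embedding `ℕ²`-exponents ↦ `ℝ²` used by the route (literal subterm of the crux). -/
noncomputable def emb (e : Fin 2 →₀ ℕ) : Fin 2 → ℝ := fun i => ((e i : ℕ) : ℝ)

/-- The embedding `ℕ² ↪ ℝ²` is injective. -/
theorem emb_injective : Function.Injective emb := by
  intro e e' h
  ext i
  have := congrFun h i
  simpa [emb] using this

/-- A convex lattice chain: the points `(g n, n)` where `g` has strictly increasing increments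
(`g (n+1) - g n < g (n+2) - g (n+1)`, e.g. `g n = n²` or `n(n-1)/2`) are in strictly convex position:
`(n, g n)`-type parabola points are strictly exposed by `l(X, Y) = (2n) ... `.  We use the concrete
chain `q n = (n(n-1)/2, n)` of KPTT Lemma 2 and expose `q n` by `l(X,Y) = (2n-1)·Y - 2·X`:
`l(q m) - l(q n) = -(m-n)²`. -/
noncomputable def chainPt (n : ℕ) : Fin 2 →₀ ℕ :=
  Finsupp.single 0 (n * (n - 1) / 2) + Finsupp.single 1 n

/-- First coordinate of the chain point: `n(n-1)/2`. -/
theorem chainPt_zero_apply (n : ℕ) : chainPt n 0 = n * (n - 1) / 2 := by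
  simp [chainPt]

/-- Second coordinate of the chain point: `n`. -/
theorem chainPt_one_apply (n : ℕ) : chainPt n 1 = n := by
  simp [chainPt]

/-- Distinct indices give distinct chain points (read off the second coordinate). -/
theorem chainPt_injective : Function.Injective chainPt := by
  intro n n' h
  have := congrArg (fun e => e 1) h
  simpa [chainPt_one_apply] using this

/-- `2 · (n(n-1)/2) = n(n-1)` over `ℕ` (the product of two consecutive naturals is even). -/
theorem two_mul_chainX (n : ℕ) : 2 * (n * (n - 1) / 2) = n * (n - 1) := by
  have : Even (n * (n - 1)) := Nat.even_mul_pred_self n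
  obtain ⟨r, hr⟩ := this
  omega

/-- The exposing functional for `chainPt n`: `l(X, Y) = (2n-1)·Y - 2·X` on `Fin 2 → ℝ`. -/
noncomputable def chainExp (n : ℕ) : (Fin 2 → ℝ) →ₗ[ℝ] ℝ :=
  (2 * (n : ℝ) - 1) • LinearMap.proj 1 - (2 : ℝ) • LinearMap.proj 0

/-- Evaluation of the exposing functional. -/
theorem chainExp_apply (n : ℕ) (v : Fin 2 → ℝ) :
    chainExp n v = (2 * (n : ℝ) - 1) * v 1 - 2 * v 0 := by
  simp [chainExp, smul_eq_mul]

/-- `l_n(q_m) = (2n-1)m - m(m-1)` (real form of the lattice computation). -/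
theorem chainExp_emb_chainPt (n m : ℕ) :
    chainExp n (emb (chainPt m)) = (2 * (n : ℝ) - 1) * m - (m : ℝ) * ((m : ℝ) - 1) := by
  rw [chainExp_apply]
  simp only [emb, chainPt_zero_apply, chainPt_one_apply]
  have h := two_mul_chainX m
  have hcast : (2 : ℝ) * ((m * (m - 1) / 2 : ℕ) : ℝ) = (m : ℝ) * ((m : ℝ) - 1) := by
    rcases Nat.eq_zero_or_pos m with hm | hm
    · subst hm; simp
    · have h2 : ((2 * (m * (m - 1) / 2) : ℕ) : ℝ) = ((m * (m - 1) : ℕ) : ℝ) := by rw [h]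
      rw [Nat.cast_mul, Nat.cast_mul, Nat.cast_pred hm] at h2
      exact_mod_cast h2
  linarith

/-- Strict exposure: `l_n(q_m) < l_n(q_n)` for `m ≠ n`, since the difference is `-(m-n)²`. -/
theorem chainExp_strict (n m : ℕ) (hmn : m ≠ n) :
    chainExp n (emb (chainPt m)) < chainExp n (emb (chainPt n)) := by
  rw [chainExp_emb_chainPt, chainExp_emb_chainPt]
  have : ((m : ℝ) - n) ^ 2 > 0 := by
    have : (m : ℝ) - n ≠ 0 := sub_ne_zero.mpr (by exact_mod_cast hmn)
    positivity
  nlinarith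

/-- The chain points are in strictly convex position: for any set `F` of indices,
`extremePoints (conv (emb '' chainPt '' F)) = emb '' chainPt '' F`. -/
theorem extremePoints_chain (F : Set ℕ) :
    Set.extremePoints ℝ (convexHull ℝ (emb '' (chainPt '' F))) = emb '' (chainPt '' F) := by
  apply extremePoints_convexHull_eq_of_strict_sep
  rintro x ⟨e, ⟨n, hn, rfl⟩, rfl⟩
  refine ⟨chainExp n, ?_⟩
  rintro y ⟨e', ⟨m, hm, rfl⟩, rfl⟩ hne
  apply chainExp_strict
  rintro rfl
  exact hne rfl

/-- Counting the embedded chain points. -/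
theorem ncard_emb_chain (F : Finset ℕ) :
    (emb '' (chainPt '' (F : Set ℕ))).ncard = F.card := by
  rw [Set.ncard_image_of_injective _ emb_injective, Set.ncard_image_of_injective _ chainPt_injective,
    Set.ncard_coe_finset]

/-! ## §B  Load-bearing analysis of the three hypotheses -/

open MvPolynomial in
/-- The crux with the cardinality hypothesis `∀ j, #A j ≤ t` DELETED (so `t` is a free parameter that
no longer controls anything). -/
def DissociatedFixedKWithoutCard : Prop :=
  ∀ k : ℕ, ∃ C : ℕ, ∀ (m t : ℕ) (A : Fin m → Finset (Fin 2 →₀ ℕ))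
    (f : Fin k → Fin m → MvPolynomial (Fin 2) ℂ),
    (∀ i j, (f i j).support ⊆ A j) →
    (∀ a b : Fin m → (Fin 2 →₀ ℕ), (∀ j, a j ∈ A j) → (∀ j, b j ∈ A j) → ∑ j, a j = ∑ j, b j → a = b) →
    (Set.extremePoints ℝ (convexHull ℝ ((fun e : Fin 2 →₀ ℕ => fun i : Fin 2 => ((e i : ℕ) : ℝ)) ''
      ((∑ i, ∏ j, f i j).support : Set (Fin 2 →₀ ℕ))))).ncard ≤ (m * t + 2) ^ C

/-- The crux with the support hypothesis `∀ i j, supp f i j ⊆ A j` DELETED (so `A`, `t` and the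
dissociation hypothesis no longer talk about `f`). -/
def DissociatedFixedKWithoutSupp : Prop :=
  ∀ k : ℕ, ∃ C : ℕ, ∀ (m t : ℕ) (A : Fin m → Finset (Fin 2 →₀ ℕ))
    (f : Fin k → Fin m → MvPolynomial (Fin 2) ℂ),
    (∀ j, (A j).card ≤ t) →
    (∀ a b : Fin m → (Fin 2 →₀ ℕ), (∀ j, a j ∈ A j) → (∀ j, b j ∈ A j) → ∑ j, a j = ∑ j, b j → a = b) →
    (Set.extremePoints ℝ (convexHull ℝ ((fun e : Fin 2 →₀ ℕ => fun i : Fin 2 => ((e i : ℕ) : ℝ)) ''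
      ((∑ i, ∏ j, f i j).support : Set (Fin 2 →₀ ℕ))))).ncard ≤ (m * t + 2) ^ C

/-- The crux with DISSOCIATION (injectivity of the sum map on `Π_j A j`) DELETED.  Status: OPEN.
True for `k ≤ 1` (no cancellation: Newton polygon of a product is the Minkowski sum, ≤ `m t` vertices);
for `k = 2` it asserts `#vert Newt(Π_j f_j + Π_j g_j) ≤ (mt+2)^C` for `t`-sparse factors — a
polynomial-in-`mt` strengthening of the sibling crux `TwoProducts` (which allows `2^{am}`), containing
KPTT's §5 open problems (`fg + 1`, `f₁⋯f_m + 1`).  No counterexample is known or was found; a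
refutation would need `2^{Ω(m)}` hull vertices carved by TWO products out of a coinciding (non-injective)
grid — impossible in the injective regime by the crux itself. -/
def DissociatedFixedKWithoutDissoc : Prop :=
  ∀ k : ℕ, ∃ C : ℕ, ∀ (m t : ℕ) (A : Fin m → Finset (Fin 2 →₀ ℕ))
    (f : Fin k → Fin m → MvPolynomial (Fin 2) ℂ),
    (∀ j, (A j).card ≤ t) → (∀ i j, (f i j).support ⊆ A j) →
    (Set.extremePoints ℝ (convexHull ℝ ((fun e : Fin 2 →₀ ℕ => fun i : Fin 2 => ((e i : ℕ) : ℝ)) ''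
      ((∑ i, ∏ j, f i j).support : Set (Fin 2 →₀ ℕ))))).ncard ≤ (m * t + 2) ^ C


/-! ### The witness polynomial: one monomial per chain point -/

open MvPolynomial

/-- `chainPoly F = Σ_{n ∈ F} X^{n(n-1)/2} Y^n` (coefficients `1`). -/
noncomputable def chainPoly (F : Finset ℕ) : MvPolynomial (Fin 2) ℂ :=
  ∑ n ∈ F, monomial (chainPt n) 1

/-- Coefficient of `chainPoly F` at a chain point. -/
theorem coeff_chainPoly_chainPt (F : Finset ℕ) (n : ℕ) :
    coeff (chainPt n) (chainPoly F) = if n ∈ F then 1 else 0 := by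
  simp only [chainPoly, coeff_sum, coeff_monomial]
  have : ∀ n' ∈ F, (if chainPt n' = chainPt n then (1 : ℂ) else 0) = if n = n' then 1 else 0 := by
    intro n' _
    rcases eq_or_ne n n' with h | h
    · subst h; simp
    · have : chainPt n' ≠ chainPt n := fun h' => h (chainPt_injective h').symm
      simp [this, h]
  rw [Finset.sum_congr rfl this, Finset.sum_ite_eq]

/-- The support of `chainPoly F` is exactly the set of chain points indexed by `F`. -/
theorem support_chainPoly (F : Finset ℕ) : (chainPoly F).support = F.image chainPt := by
  apply Finset.Subset.antisymm
  · intro d hd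
    have := support_sum (s := F) (f := fun n => monomial (chainPt n) (1 : ℂ)) hd
    simp only [Finset.mem_biUnion] at this
    obtain ⟨n, hn, hdn⟩ := this
    have := support_monomial_subset hdn
    simp only [Finset.mem_singleton] at this
    exact Finset.mem_image.mpr ⟨n, hn, this.symm⟩
  · intro d hd
    obtain ⟨n, hn, rfl⟩ := Finset.mem_image.mp hd
    rw [mem_support_iff, coeff_chainPoly_chainPt]
    simp [hn]

/-- `chainPoly F` has exactly `#F` Newton-polygon vertices (crux's literal vertex count). -/
theorem vertices_chainPoly (F : Finset ℕ) :
    (Set.extremePoints ℝ (convexHull ℝ ((fun e : Fin 2 →₀ ℕ => fun i : Fin 2 => ((e i : ℕ) : ℝ)) ''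
      ((chainPoly F).support : Set (Fin 2 →₀ ℕ))))).ncard = F.card := by
  rw [show (fun e : Fin 2 →₀ ℕ => fun i : Fin 2 => ((e i : ℕ) : ℝ)) = emb from rfl,
    support_chainPoly, Finset.coe_image, extremePoints_chain, ncard_emb_chain]

/-- A `Fin 1 × Fin 1` sum of products is its single entry. -/
theorem sum_prod_fin_one (g : Fin 1 → Fin 1 → MvPolynomial (Fin 2) ℂ) :
    (∑ i : Fin 1, ∏ j : Fin 1, g i j) = g 0 0 := by
  simp

/-! ### §B theorems: the two bookkeeping hypotheses are (formally) load-bearing -/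

/-- With `#A j ≤ t` deleted the crux is FALSE: at `k = 1`, `m = 1`, `t = 0` the bound is the constant
`2^C`, but `A 0 = ` `2^C + 1` chain points and `f 0 0 = chainPoly` has `2^C + 1` vertices.  So the proof
must use `#A j ≤ t` — of course only as bookkeeping (`t` is what the bound is measured in). -/
theorem dissociatedFixedK_false_without_card : ¬ DissociatedFixedKWithoutCard := by
  intro h
  obtain ⟨C, hC⟩ := h 1
  have hle := hC 1 0 (fun _ => (Finset.range (2 ^ C + 1)).image chainPt)
    (fun _ _ => chainPoly (Finset.range (2 ^ C + 1)))
    (fun _ _ => by rw [support_chainPoly])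
    (fun a b ha hb hab => by
      funext j
      fin_cases j
      simpa using hab)
  rw [sum_prod_fin_one, vertices_chainPoly, Finset.card_range] at hle
  simp at hle

/-- With `supp f i j ⊆ A j` deleted the crux is FALSE: take `A j = ∅` (so `t = 0` and dissociation is
vacuous) and the same `f`.  So the proof must use the support hypothesis (bookkeeping again). -/
theorem dissociatedFixedK_false_without_supp : ¬ DissociatedFixedKWithoutSupp := by
  intro h
  obtain ⟨C, hC⟩ := h 1
  have hle := hC 1 0 (fun _ => ∅) (fun _ _ => chainPoly (Finset.range (2 ^ C + 1)))
    (fun _ => by simp)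
    (fun a b ha _ _ => by simpa using ha 0)
  rw [sum_prod_fin_one, vertices_chainPoly, Finset.card_range] at hle
  simp at hle


/-- Base-`B` digit `j` of `x`. -/
def digit (B x j : ℕ) : ℕ := x / B ^ j % B

/-- Digits are `< B`. -/
theorem digit_lt {B : ℕ} (hB : 0 < B) (x j : ℕ) : digit B x j < B := Nat.mod_lt _ hB

/-- Digit expansion: `Σ_{j<m} B^j · digit_j(x) = x` for `x < B^m`. -/
theorem sum_pow_mul_digit {B : ℕ} (hB : 0 < B) :
    ∀ (m x : ℕ), x < B ^ m → (∑ j : Fin m, B ^ (j : ℕ) * digit B x j) = x := by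
  intro m
  induction m with
  | zero => intro x hx; simp at hx; simp [hx]
  | succ m ih =>
    intro x hx
    rw [Fin.sum_univ_succ]
    simp only [Fin.val_zero, pow_zero, one_mul, Fin.val_succ]
    have hdiv : x / B < B ^ m := by
      rw [Nat.div_lt_iff_lt_mul hB]; simpa [pow_succ] using hx
    have key : ∀ j : Fin m, B ^ ((j : ℕ) + 1) * digit B x ((j : ℕ) + 1) =
        B * (B ^ (j : ℕ) * digit B (x / B) j) := by
      intro j
      simp only [digit, pow_succ, Nat.div_div_eq_div_mul]
      ring_nf
    rw [Finset.sum_congr rfl (fun j _ => key j), ← Finset.mul_sum, ih (x / B) hdiv]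
    simp only [digit, pow_zero, Nat.div_one]
    exact Nat.mod_add_div x B

/-- Uniqueness of digits: two digit vectors (entries `< B`) with the same value are equal. -/
theorem digits_unique {B : ℕ} (hB : 0 < B) :
    ∀ (m : ℕ) (d e : Fin m → ℕ), (∀ j, d j < B) → (∀ j, e j < B) →
      (∑ j : Fin m, B ^ (j : ℕ) * d j) = (∑ j : Fin m, B ^ (j : ℕ) * e j) → d = e := by
  intro m
  induction m with
  | zero => intro d e _ _ _; funext j; exact Fin.elim0 j
  | succ m ih =>
    intro d e hd he h
    rw [Fin.sum_univ_succ, Fin.sum_univ_succ] at h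
    simp only [Fin.val_zero, pow_zero, one_mul, Fin.val_succ, pow_succ] at h
    have hsplit : ∀ (c : Fin (m+1) → ℕ),
        (∑ j : Fin m, B ^ (j : ℕ) * B * c j.succ) = B * ∑ j : Fin m, B ^ (j : ℕ) * c j.succ := by
      intro c; rw [Finset.mul_sum]; apply Finset.sum_congr rfl; intro j _; ring
    rw [hsplit d, hsplit e] at h
    -- compare modulo B and divide by B
    have h0 : d 0 = e 0 := by
      have := congrArg (· % B) h
      simpa [Nat.add_mul_mod_self_left, Nat.mod_eq_of_lt (hd 0), Nat.mod_eq_of_lt (he 0)] using this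
    have htail : (∑ j : Fin m, B ^ (j : ℕ) * d j.succ) = (∑ j : Fin m, B ^ (j : ℕ) * e j.succ) := by
      rw [h0] at h
      have h' := Nat.add_left_cancel h
      exact Nat.eq_of_mul_eq_mul_left hB h'
    have := ih (fun j => d j.succ) (fun j => e j.succ) (fun j => hd _) (fun j => he _) htail
    funext j
    refine Fin.cases h0 (fun j => ?_) j
    exact congrFun this j


/-! ## §C  The strengthening "one exponent `C` for every `k`" is FALSE (KPTT Example 3 / Lemma 2) -/

/-- `DissociatedFixedK` with the quantifiers `∀ k, ∃ C` swapped to `∃ C, ∀ k`. -/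
def DissociatedFixedKUniformC : Prop :=
  ∃ C : ℕ, ∀ (k m t : ℕ) (A : Fin m → Finset (Fin 2 →₀ ℕ))
    (f : Fin k → Fin m → MvPolynomial (Fin 2) ℂ),
    (∀ j, (A j).card ≤ t) → (∀ i j, (f i j).support ⊆ A j) →
    (∀ a b : Fin m → (Fin 2 →₀ ℕ), (∀ j, a j ∈ A j) → (∀ j, b j ∈ A j) → ∑ j, a j = ∑ j, b j → a = b) →
    (Set.extremePoints ℝ (convexHull ℝ ((fun e : Fin 2 →₀ ℕ => fun i : Fin 2 => ((e i : ℕ) : ℝ)) ''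
      ((∑ i, ∏ j, f i j).support : Set (Fin 2 →₀ ℕ))))).ncard ≤ (m * t + 2) ^ C

/-- KPTT Example 3 (arXiv:1308.2286 p. 7): the `j`-th digit grid
`P_j = {(b^{2j} i, b^j i') : i < b², i' < b}`, `#P_j ≤ b³`; `P_0 + ⋯ + P_{m-1}` is the full box
`[0, b^{2m}) × [0, b^m)` with UNIQUE representations (dissociated). -/
noncomputable def digitGrid (b j : ℕ) : Finset (Fin 2 →₀ ℕ) :=
  ((Finset.range (b ^ 2)) ×ˢ (Finset.range b)).image
    (fun p => Finsupp.single 0 (b ^ (2 * j) * p.1) + Finsupp.single 1 (b ^ j * p.2))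

/-- `#P_j ≤ b³` (`= t`). -/
theorem card_digitGrid_le (b j : ℕ) : (digitGrid b j).card ≤ b ^ 3 := by
  refine Finset.card_image_le.trans ?_
  rw [Finset.card_product, Finset.card_range, Finset.card_range]
  ring_nf
  exact le_rfl

/-- The digit tuple of the chain point `(y(y-1)/2, y)`: its `j`-th entry lies in `P_j`. -/
noncomputable def digitPt (b y j : ℕ) : Fin 2 →₀ ℕ :=
  Finsupp.single 0 (b ^ (2 * j) * digit (b ^ 2) (y * (y - 1) / 2) j) +
    Finsupp.single 1 (b ^ j * digit b y j)

/-- The `j`-th digit tuple entry of a chain point lies in the `j`-th digit grid. -/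
theorem digitPt_mem (b y j : ℕ) (hb : 0 < b) : digitPt b y j ∈ digitGrid b j := by
  refine Finset.mem_image.mpr ⟨(digit (b ^ 2) (y * (y - 1) / 2) j, digit b y j), ?_, rfl⟩
  simp only [Finset.mem_product, Finset.mem_range]
  exact ⟨digit_lt (by positivity) _ _, digit_lt hb _ _⟩

/-- The first coordinate `y(y-1)/2` of a chain point with `y < b^m` fits in `m` base-`b²` digits. -/
theorem chainX_lt {b m y : ℕ} (hy : y < b ^ m) : y * (y - 1) / 2 < (b ^ 2) ^ m := by
  have h1 : y * (y - 1) / 2 ≤ y * (y - 1) := Nat.div_le_self _ _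
  have h2 : y * (y - 1) ≤ y * y := Nat.mul_le_mul_left _ (Nat.sub_le _ _)
  have h3 : y * y < b ^ m * b ^ m := Nat.mul_lt_mul'' hy hy
  rw [← pow_mul, mul_comm 2 m, pow_mul, pow_two]
  omega

/-- The digit tuple of a chain point sums to the chain point (digit expansion in bases `b²` and `b`). -/
theorem sum_digitPt {b m : ℕ} (hb : 0 < b) (y : ℕ) (hy : y < b ^ m) :
    (∑ j : Fin m, digitPt b y j) = chainPt y := by
  simp only [digitPt, Finset.sum_add_distrib, ← Finsupp.single_finsetSum, chainPt]
  congr 1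
  · congr 1
    have := sum_pow_mul_digit (B := b ^ 2) (by positivity) m (y * (y - 1) / 2) (chainX_lt hy)
    refine Eq.trans ?_ this
    apply Finset.sum_congr rfl
    intro j _
    rw [← pow_mul]
  · congr 1
    exact sum_pow_mul_digit hb m y hy

/-- A product of coefficient-one monomials is the monomial of the exponent sum. -/
theorem prod_monomial_one {σ R : Type*} [CommSemiring R] :
    ∀ (m : ℕ) (s : Fin m → σ →₀ ℕ),
      (∏ j : Fin m, MvPolynomial.monomial (s j) (1 : R)) = MvPolynomial.monomial (∑ j, s j) 1 := by
  intro m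
  induction m with
  | zero => intro s; simp
  | succ m ih =>
    intro s
    rw [Fin.prod_univ_succ, Fin.sum_univ_succ, ih (fun j => s j.succ), MvPolynomial.monomial_mul, one_mul]

/-- The witness sum of products of monomials IS `chainPoly (range k)` when `k ≤ b^m`. -/
theorem sum_prod_digit_monomials {b m k : ℕ} (hb : 0 < b) (hk : k ≤ b ^ m) :
    (∑ y : Fin k, ∏ j : Fin m, MvPolynomial.monomial (digitPt b y j) (1 : ℂ)) =
      chainPoly (Finset.range k) := by
  have : ∀ y : Fin k, (∏ j : Fin m, MvPolynomial.monomial (digitPt b y j) (1 : ℂ)) =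
      MvPolynomial.monomial (chainPt y) 1 := by
    intro y
    rw [prod_monomial_one, sum_digitPt hb (y : ℕ) (lt_of_lt_of_le y.2 hk)]
  simp only [this, chainPoly]
  exact Fin.sum_univ_eq_sum_range (fun y => MvPolynomial.monomial (chainPt y) (1 : ℂ)) k

/-- The digit grids are dissociated: the sum map is injective on `Π_j P_j`. -/
theorem digitGrid_dissociated {b : ℕ} (hb : 0 < b) (m : ℕ) (a c : Fin m → (Fin 2 →₀ ℕ))
    (ha : ∀ j : Fin m, a j ∈ digitGrid b j) (hc : ∀ j : Fin m, c j ∈ digitGrid b j)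
    (h : ∑ j, a j = ∑ j, c j) : a = c := by
  choose p hp hpa using fun j => Finset.mem_image.mp (ha j)
  choose q hq hqc using fun j => Finset.mem_image.mp (hc j)
  simp only [Finset.mem_product, Finset.mem_range] at hp hq
  have h0 := congrArg (fun e => e 0) h
  have h1 := congrArg (fun e => e 1) h
  simp only [Finsupp.finsetSum_apply] at h0 h1
  have ha0 : ∀ j, a j 0 = (b ^ 2) ^ (j : ℕ) * (p j).1 := by
    intro j; rw [← hpa j, ← pow_mul]; simp
  have ha1 : ∀ j, a j 1 = b ^ (j : ℕ) * (p j).2 := by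
    intro j; rw [← hpa j]; simp
  have hc0 : ∀ j, c j 0 = (b ^ 2) ^ (j : ℕ) * (q j).1 := by
    intro j; rw [← hqc j, ← pow_mul]; simp
  have hc1 : ∀ j, c j 1 = b ^ (j : ℕ) * (q j).2 := by
    intro j; rw [← hqc j]; simp
  simp only [ha0, hc0] at h0
  simp only [ha1, hc1] at h1
  have e1 := digits_unique (B := b ^ 2) (by positivity) m (fun j => (p j).1) (fun j => (q j).1)
    (fun j => (hp j).1) (fun j => (hq j).1) h0
  have e2 := digits_unique hb m (fun j => (p j).2) (fun j => (q j).2)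
    (fun j => (hp j).2) (fun j => (hq j).2) h1
  funext j
  rw [← hpa j, ← hqc j, show (p j).1 = (q j).1 from congrFun e1 j,
    show (p j).2 = (q j).2 from congrFun e2 j]

/-- The arithmetic of the witness: with `m = 3C+3`, `b = (3C+5)^C + 1`, `t = b³`:
`(m t + 2)^C < b^m` (`= t^{C+1}`, the number of chain points). -/
theorem uniformC_arith (C : ℕ) :
    ((3 * C + 3) * ((3 * C + 5) ^ C + 1) ^ 3 + 2) ^ C < ((3 * C + 5) ^ C + 1) ^ (3 * C + 3) := by
  set b := (3 * C + 5) ^ C + 1 with hb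
  set m := 3 * C + 3 with hm
  have hb1 : 1 ≤ b := by simp [hb]
  have ht1 : 1 ≤ b ^ 3 := Nat.one_le_pow _ _ hb1
  have h1 : m * b ^ 3 + 2 ≤ (m + 2) * b ^ 3 := by nlinarith
  have h2 : (m * b ^ 3 + 2) ^ C ≤ ((m + 2) * b ^ 3) ^ C := Nat.pow_le_pow_left h1 C
  have h4 : (m + 2) ^ C < b := by simp [hb, hm]
  have h5 : ((m + 2) * b ^ 3) ^ C = (m + 2) ^ C * (b ^ 3) ^ C := Nat.mul_pow _ _ _
  have h6 : (m + 2) ^ C * (b ^ 3) ^ C < b * (b ^ 3) ^ C :=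
    Nat.mul_lt_mul_of_pos_right h4 (by positivity)
  have h7 : b * (b ^ 3) ^ C = b ^ (3 * C + 1) := by rw [← pow_mul, pow_succ']
  have h8 : b ^ (3 * C + 1) ≤ b ^ (3 * C + 3) := Nat.pow_le_pow_right hb1 (by omega)
  calc (m * b ^ 3 + 2) ^ C ≤ ((m + 2) * b ^ 3) ^ C := h2
    _ = (m + 2) ^ C * (b ^ 3) ^ C := h5
    _ < b * (b ^ 3) ^ C := h6
    _ = b ^ (3 * C + 1) := h7
    _ ≤ b ^ (3 * C + 3) := h8

/-- **The uniform-exponent strengthening of `DissociatedFixedK` is false** (KPTT arXiv:1308.2286,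
Example 3 + Lemma 2, p. 7, made explicit): for every `C`, the dissociated digit grids with
`b = (3C+5)^C + 1`, `t = b³`, `m = 3C+3` factors and `k = b^m` products of MONOMIALS realise the
`b^m = t^{C+1}` chain points `(y(y-1)/2, y)`, `y < b^m`, all of which are vertices; and
`t^{C+1} > (mt+2)^C`.  Hence in the crux the exponent `C = C(k)` must tend to infinity with `k`
(quantitatively `(8 log₂k + 2)^{C(k)} ≥ k` taking `b = 2`, i.e. `C(k) ≳ log k / log log k`), while the
blueprint proves `C(k) = O(k)`; the gap is the sibling crux `DissociatedUniform`. -/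
theorem not_dissociatedFixedKUniformC : ¬ DissociatedFixedKUniformC := by
  rintro ⟨C, hC⟩
  set b := (3 * C + 5) ^ C + 1 with hb
  set m := 3 * C + 3 with hm
  have hb0 : 0 < b := by simp [hb]
  have hle := hC (b ^ m) m (b ^ 3) (fun j => digitGrid b j)
    (fun y j => MvPolynomial.monomial (digitPt b y j) 1)
    (fun j => card_digitGrid_le b j)
    (fun y j => (MvPolynomial.support_monomial_subset).trans
      (Finset.singleton_subset_iff.mpr (digitPt_mem b y j hb0)))
    (fun a c ha hc h => digitGrid_dissociated hb0 m a c ha hc h)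
  rw [sum_prod_digit_monomials hb0 le_rfl, vertices_chainPoly, Finset.card_range] at hle
  exact absurd (uniformC_arith C) (not_lt.mpr hle)


/-! ## §E  PROVER KIT — the remaining standalone ingredients of the blueprint (all CHECKED) -/

/-! ## §E0  Blueprint step 2: extreme points of a finite planar set are strictly exposed -/

/-- **Blueprint step 2 (exposure), prover-facing.**  An extreme point of the convex hull of a FINITE
set in a normed space (used: `Fin 2 → ℝ`) is strictly exposed by a continuous linear functional:
`l y < l x` for every other point `y` of the set.  (Hahn–Banach against the compact convex hull of the
other points.) [folklore] -/
theorem exists_strict_sep_of_mem_extremePoints_convexHull {E : Type*} [NormedAddCommGroup E]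
    [NormedSpace ℝ E] {S : Set E} (hS : S.Finite) {x : E}
    (hx : x ∈ Set.extremePoints ℝ (convexHull ℝ S)) :
    ∃ l : E →L[ℝ] ℝ, ∀ y ∈ S, y ≠ x → l y < l x := by
  have hxS : x ∈ S := extremePoints_convexHull_subset hx
  set S' : Set E := S \ {x} with hS'
  have hS'fin : S'.Finite := hS.subset Set.sdiff_subset
  have hK : IsCompact (convexHull ℝ S') := Set.Finite.isCompact_convexHull (𝕜 := ℝ) hS'fin
  have hxK : x ∉ convexHull ℝ S' := by
    intro hmem
    have h := ((convex_convexHull ℝ S).mem_extremePoints_iff_mem_sdiff_convexHull_sdiff).mp hx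
    apply h.2
    refine convexHull_mono ?_ hmem
    intro y hy
    exact ⟨subset_convexHull ℝ S hy.1, hy.2⟩
  obtain ⟨f, u, hfx, hfb⟩ :=
    geometric_hahn_banach_point_closed (convex_convexHull ℝ S') hK.isClosed hxK
  refine ⟨-f, ?_⟩
  intro y hy hne
  have : u < f y := hfb y (subset_convexHull ℝ S' ⟨hy, hne⟩)
  show -f y < -f x
  linarith


/-! ## §E1  Blueprint step 1: in the dissociated regime the coefficient IS the rank-`k` tensor -/

section Coeff

variable {R : Type*} [CommSemiring R] {σ : Type*}

/-- A polynomial whose support lies in `A` is the sum of its terms over `A`. -/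
theorem eq_sum_monomial_of_support_subset (p : MvPolynomial σ R) (A : Finset (σ →₀ ℕ))
    (h : p.support ⊆ A) : p = ∑ e ∈ A, monomial e (coeff e p) := by
  conv_lhs => rw [p.as_sum]
  apply Finset.sum_subset h
  intro e _ he
  rw [notMem_support_iff.mp he, monomial_zero]

/-- Expansion of a product of polynomials with supports in the letter sets `A j`:
`Π_j f_j = Σ_{g ∈ Π_j A_j} (Π_j coeff (g j) f_j) · X^{Σ_j g j}`. -/
theorem prod_eq_sum_piFinset {m : ℕ} (A : Fin m → Finset (σ →₀ ℕ)) (f : Fin m → MvPolynomial σ R)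
    (hsupp : ∀ j, (f j).support ⊆ A j) :
    (∏ j, f j) = ∑ g ∈ Fintype.piFinset A, monomial (∑ j, g j) (∏ j, coeff (g j) (f j)) := by
  have : (∏ j, f j) = ∏ j, ∑ e ∈ A j, monomial e (coeff e (f j)) :=
    Finset.prod_congr rfl (fun j _ => eq_sum_monomial_of_support_subset (f j) (A j) (hsupp j))
  rw [this, Finset.prod_univ_sum]
  apply Finset.sum_congr rfl
  intro g _
  rw [monomial_sum_prod]

/-- **Coefficient formula (blueprint step 1).**  With `supp f_ij ⊆ A_j` and the sum map injective on
`Π_j A_j`, the coefficient of `X^{Σ_j a_j}` in `Σ_i Π_j f_ij` is the tensor value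
`T(a) = Σ_i Π_j coeff (a j) (f i j)`. -/
theorem coeff_sum_prod_of_dissociated {k m : ℕ} (A : Fin m → Finset (σ →₀ ℕ))
    (f : Fin k → Fin m → MvPolynomial σ R) (hsupp : ∀ i j, (f i j).support ⊆ A j)
    (hinj : ∀ a b : Fin m → (σ →₀ ℕ), (∀ j, a j ∈ A j) → (∀ j, b j ∈ A j) →
      ∑ j, a j = ∑ j, b j → a = b)
    (a : Fin m → (σ →₀ ℕ)) (ha : ∀ j, a j ∈ A j) :
    coeff (∑ j, a j) (∑ i, ∏ j, f i j) = ∑ i, ∏ j, coeff (a j) (f i j) := by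
  classical
  rw [coeff_sum]
  apply Finset.sum_congr rfl
  intro i _
  rw [prod_eq_sum_piFinset A (f i) (hsupp i), coeff_sum]
  have hamem : a ∈ Fintype.piFinset A := Fintype.mem_piFinset.mpr ha
  rw [Finset.sum_eq_single_of_mem a hamem]
  · simp
  · intro g hg hga
    rw [coeff_monomial, if_neg]
    intro hsum
    exact hga (hinj g a (Fintype.mem_piFinset.mp hg) ha hsum)

/-- **Support formula (blueprint step 1).**  Every exponent in the support of `Σ_i Π_j f_ij` is
`Σ_j a_j` for a grid word `a ∈ Π_j A_j` with `T(a) ≠ 0`. -/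
theorem exists_word_of_mem_support {k m : ℕ} (A : Fin m → Finset (σ →₀ ℕ))
    (f : Fin k → Fin m → MvPolynomial σ R) (hsupp : ∀ i j, (f i j).support ⊆ A j)
    (hinj : ∀ a b : Fin m → (σ →₀ ℕ), (∀ j, a j ∈ A j) → (∀ j, b j ∈ A j) →
      ∑ j, a j = ∑ j, b j → a = b)
    {e : σ →₀ ℕ} (he : e ∈ (∑ i, ∏ j, f i j).support) :
    ∃ a : Fin m → (σ →₀ ℕ), (∀ j, a j ∈ A j) ∧ ∑ j, a j = e ∧
      ∑ i, ∏ j, coeff (a j) (f i j) ≠ 0 := by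
  classical
  -- the support of the sum of products lies in the image of the grid
  have hsub : (∑ i, ∏ j, f i j).support ⊆
      (Fintype.piFinset A).image (fun g => ∑ j, g j) := by
    refine (MvPolynomial.support_sum).trans ?_
    intro e' he'
    simp only [Finset.mem_biUnion, Finset.mem_univ, true_and] at he'
    obtain ⟨i, hi⟩ := he'
    rw [prod_eq_sum_piFinset A (f i) (hsupp i)] at hi
    have := MvPolynomial.support_sum hi
    simp only [Finset.mem_biUnion] at this
    obtain ⟨g, hg, hge⟩ := this
    have := support_monomial_subset hge
    simp only [Finset.mem_singleton] at this
    exact Finset.mem_image.mpr ⟨g, hg, this.symm⟩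
  obtain ⟨a, ha, rfl⟩ := Finset.mem_image.mp (hsub he)
  refine ⟨a, Fintype.mem_piFinset.mp ha, rfl, ?_⟩
  rw [← coeff_sum_prod_of_dissociated A f hsupp hinj a (Fintype.mem_piFinset.mp ha)]
  exact mem_support_iff.mp he

end Coeff



/-! ## §E2  Blueprint step 4 (counting): sign patterns along a one-parameter sweep -/

section Sweep

/-- The sign vector of the affine functions `λ ↦ d.1 + λ·d.2`, `d ∈ D`, at the parameter `λ`. -/
noncomputable def signVec (D : Finset (ℝ × ℝ)) (t : ℝ) : ↥D → SignType :=
  fun d => SignType.sign (d.1.1 + t * d.1.2)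

/-- The roots of the non-constant affine functions. -/
noncomputable def sweepRoots (D : Finset (ℝ × ℝ)) : Finset ℝ :=
  (D.filter (fun d => d.2 ≠ 0)).image (fun d => -d.1 / d.2)

theorem card_sweepRoots_le (D : Finset (ℝ × ℝ)) : (sweepRoots D).card ≤ D.card :=
  Finset.card_image_le.trans (Finset.card_filter_le _ _)

/-- The combinatorial position of `λ` relative to the roots: (number of roots below, is a root). -/
noncomputable def sweepKey (D : Finset (ℝ × ℝ)) (t : ℝ) : ℕ × Bool :=
  (((sweepRoots D).filter (fun r => r < t)).card, decide (t ∈ sweepRoots D))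

theorem sweepKey_mem (D : Finset (ℝ × ℝ)) (t : ℝ) :
    sweepKey D t ∈ (Finset.range ((sweepRoots D).card + 1) ×ˢ (Finset.univ : Finset Bool)) := by
  simp only [sweepKey, Finset.mem_product, Finset.mem_range, Finset.mem_univ, and_true]
  exact Nat.lt_succ_of_le (Finset.card_filter_le _ _)

/-- Core of the sweep: between (and off) the roots the sign vector is constant.  Version `t < t'`. -/
theorem signVec_eq_of_sweepKey_eq_of_lt (D : Finset (ℝ × ℝ)) {t t' : ℝ} (htt' : t < t')
    (hkey : sweepKey D t = sweepKey D t') : signVec D t = signVec D t' := by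
  have hsub : (sweepRoots D).filter (fun r => r < t) ⊆ (sweepRoots D).filter (fun r => r < t') := by
    intro r hr
    simp only [Finset.mem_filter] at hr ⊢
    exact ⟨hr.1, hr.2.trans htt'⟩
  have hcard : ((sweepRoots D).filter (fun r => r < t)).card =
      ((sweepRoots D).filter (fun r => r < t')).card := congrArg Prod.fst hkey
  -- no root in `[t, t')`
  have hnoroot : ∀ r ∈ sweepRoots D, ¬ (t ≤ r ∧ r < t') := by
    rintro r hr ⟨h1, h2⟩
    have hss : (sweepRoots D).filter (fun r => r < t) ⊂ (sweepRoots D).filter (fun r => r < t') := by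
      refine Finset.ssubset_iff_of_subset hsub |>.mpr ⟨r, ?_, ?_⟩
      · simp [hr, h2]
      · simp [not_lt.mpr h1]
    exact absurd hcard (Finset.card_lt_card hss).ne
  have ht : t ∉ sweepRoots D := fun h => hnoroot t h ⟨le_rfl, htt'⟩
  have ht' : t' ∉ sweepRoots D := by
    have := congrArg Prod.snd hkey
    simp only [sweepKey, decide_eq_decide] at this
    exact fun h => ht (this.mpr h)
  funext d
  simp only [signVec]
  by_cases hd2 : d.1.2 = 0
  · simp [hd2]
  · set r : ℝ := -d.1.1 / d.1.2 with hr
    have hrmem : r ∈ sweepRoots D :=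
      Finset.mem_image.mpr ⟨d.1, Finset.mem_filter.mpr ⟨d.2, hd2⟩, rfl⟩
    have hfac : ∀ s : ℝ, d.1.1 + s * d.1.2 = d.1.2 * (s - r) := by
      intro s; rw [hr]; field_simp; ring
    rw [hfac t, hfac t', sign_mul, sign_mul]
    congr 1
    have htr : t ≠ r := fun h => ht (h ▸ hrmem)
    have ht'r : t' ≠ r := fun h => ht' (h ▸ hrmem)
    rcases lt_or_gt_of_ne htr with h | h
    · -- t < r : then also t' < r (no root in [t, t'))
      have h' : t' < r := by
        rcases lt_or_gt_of_ne ht'r with h' | h'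
        · exact h'
        · exact absurd ⟨h.le, h'⟩ (hnoroot r hrmem)
      rw [sign_neg (sub_neg.mpr h), sign_neg (sub_neg.mpr h')]
    · have h' : r < t' := h.trans htt'
      rw [sign_pos (sub_pos.mpr h), sign_pos (sub_pos.mpr h')]

theorem signVec_eq_of_sweepKey_eq (D : Finset (ℝ × ℝ)) {t t' : ℝ}
    (hkey : sweepKey D t = sweepKey D t') : signVec D t = signVec D t' := by
  rcases lt_trichotomy t t' with h | rfl | h
  · exact signVec_eq_of_sweepKey_eq_of_lt D h hkey
  · rfl
  · exact (signVec_eq_of_sweepKey_eq_of_lt D h hkey.symm).symm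

/-- **Sweep count.** The sign vectors of `|D|` affine functions of one real parameter take at most
`2|D| + 2` values. [folklore] -/
theorem ncard_range_signVec_le (D : Finset (ℝ × ℝ)) :
    (Set.range (signVec D)).ncard ≤ 2 * D.card + 2 := by
  classical
  -- choose a parameter for each realised sign vector and map it to its key
  have hchoose : ∀ s ∈ Set.range (signVec D), ∃ t, signVec D t = s := fun s hs => hs
  choose par hpar using hchoose
  set T : Finset (ℕ × Bool) :=
    Finset.range ((sweepRoots D).card + 1) ×ˢ (Finset.univ : Finset Bool) with hT
  have hmaps : ∀ s (hs : s ∈ Set.range (signVec D)), sweepKey D (par s hs) ∈ (T : Set (ℕ × Bool)) :=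
    fun s hs => by exact_mod_cast sweepKey_mem D (par s hs)
  -- injectivity of s ↦ key (par s) on the range
  let φ : (↥D → SignType) → ℕ × Bool := fun s =>
    if hs : s ∈ Set.range (signVec D) then sweepKey D (par s hs) else (0, false)
  have hφmaps : ∀ s ∈ Set.range (signVec D), φ s ∈ (T : Set (ℕ × Bool)) := by
    intro s hs; simp only [φ, dif_pos hs]; exact hmaps s hs
  have hφinj : Set.InjOn φ (Set.range (signVec D)) := by
    intro s hs s' hs' h
    simp only [φ, dif_pos hs, dif_pos hs'] at h
    rw [← hpar s hs, ← hpar s' hs']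
    exact signVec_eq_of_sweepKey_eq D h
  have h1 : (Set.range (signVec D)).ncard ≤ (T : Set (ℕ × Bool)).ncard :=
    Set.ncard_le_ncard_of_injOn φ hφmaps hφinj (Finset.finite_toSet T)
  rw [Set.ncard_coe_finset] at h1
  have h2 : T.card = ((sweepRoots D).card + 1) * 2 := by
    simp [hT, Finset.card_product]
  have h3 := card_sweepRoots_le D
  calc (Set.range (signVec D)).ncard ≤ T.card := h1
    _ = ((sweepRoots D).card + 1) * 2 := h2
    _ ≤ 2 * D.card + 2 := by omega

end Sweep


/-! ## §E3  Comparison patterns of linear functionals on a finite planar point set -/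

section CmpPat

/-- The comparison pattern a continuous linear functional induces on a finite point set. -/
noncomputable def cmpPat (P : Finset (Fin 2 → ℝ)) (l : (Fin 2 → ℝ) →L[ℝ] ℝ) : ↥P × ↥P → Bool :=
  fun pq => decide (l pq.1 < l pq.2)

/-- The difference vectors of `P`, as pairs of reals. -/
noncomputable def diffSet (P : Finset (Fin 2 → ℝ)) : Finset (ℝ × ℝ) :=
  (P ×ˢ P).image (fun pq => (pq.2 0 - pq.1 0, pq.2 1 - pq.1 1))

theorem card_diffSet_le (P : Finset (Fin 2 → ℝ)) : (diffSet P).card ≤ P.card * P.card :=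
  Finset.card_image_le.trans (by rw [Finset.card_product])

theorem diff_mem_diffSet (P : Finset (Fin 2 → ℝ)) (pq : ↥P × ↥P) :
    ((pq.2 : Fin 2 → ℝ) 0 - (pq.1 : Fin 2 → ℝ) 0, (pq.2 : Fin 2 → ℝ) 1 - (pq.1 : Fin 2 → ℝ) 1)
      ∈ diffSet P :=
  Finset.mem_image.mpr ⟨((pq.1 : Fin 2 → ℝ), (pq.2 : Fin 2 → ℝ)),
    Finset.mem_product.mpr ⟨pq.1.2, pq.2.2⟩, rfl⟩

/-- A linear functional on `ℝ²` in coordinates. -/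
theorem clm_apply_fin_two (l : (Fin 2 → ℝ) →L[ℝ] ℝ) (v : Fin 2 → ℝ) :
    l v = l (Pi.single 0 1) * v 0 + l (Pi.single 1 1) * v 1 := by
  have hv : v = v 0 • (Pi.single 0 1 : Fin 2 → ℝ) + v 1 • (Pi.single 1 1 : Fin 2 → ℝ) := by
    funext i
    fin_cases i <;> simp
  conv_lhs => rw [hv]
  simp only [map_add, map_smul, smul_eq_mul]
  ring

/-- **Pattern count.** As `l` ranges over ALL continuous linear functionals on `ℝ²`, the comparison
pattern on a finite set `P` takes at most `4|P|² + 7` values (sweep `l = (±1, λ)`, `(0, ±1)`, `0`).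
[folklore] -/
theorem ncard_range_cmpPat_le (P : Finset (Fin 2 → ℝ)) :
    (Set.range (cmpPat P)).ncard ≤ 4 * (P.card * P.card) + 7 := by
  classical
  set D := diffSet P with hD
  -- decoders
  let dv : ↥P × ↥P → ↥D := fun pq => ⟨_, diff_mem_diffSet P pq⟩
  let Fp : (↥D → SignType) → (↥P × ↥P → Bool) := fun s pq => decide (s (dv pq) = 1)
  let Fm : (↥D → SignType) → (↥P × ↥P → Bool) := fun s pq => decide (s (dv pq) = -1)
  let G : SignType → (↥P × ↥P → Bool) := fun σ pq =>
    decide (σ * SignType.sign ((pq.2 : Fin 2 → ℝ) 1 - (pq.1 : Fin 2 → ℝ) 1) = 1)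
  have hcover : Set.range (cmpPat P) ⊆
      (Fp '' Set.range (signVec D) ∪ Fm '' Set.range (signVec D)) ∪ G '' Set.univ := by
    rintro _ ⟨l, rfl⟩
    set l₁ := l (Pi.single 0 1) with hl₁
    set l₂ := l (Pi.single 1 1) with hl₂
    have hdiff : ∀ pq : ↥P × ↥P, l pq.2 - l pq.1 =
        l₁ * ((pq.2 : Fin 2 → ℝ) 0 - (pq.1 : Fin 2 → ℝ) 0) +
          l₂ * ((pq.2 : Fin 2 → ℝ) 1 - (pq.1 : Fin 2 → ℝ) 1) := by
      intro pq
      rw [clm_apply_fin_two l (pq.2 : Fin 2 → ℝ), clm_apply_fin_two l (pq.1 : Fin 2 → ℝ)]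
      ring
    rcases lt_trichotomy 0 l₁ with h1 | h1 | h1
    · -- l₁ > 0
      left; left
      refine ⟨signVec D (l₂ / l₁), ⟨l₂ / l₁, rfl⟩, ?_⟩
      funext pq
      simp only [Fp, cmpPat, signVec, dv]
      have key : (0 : ℝ) < ((pq.2 : Fin 2 → ℝ) 0 - (pq.1 : Fin 2 → ℝ) 0) +
          l₂ / l₁ * ((pq.2 : Fin 2 → ℝ) 1 - (pq.1 : Fin 2 → ℝ) 1) ↔ l pq.1 < l pq.2 := by
        rw [← sub_pos (a := l pq.2), hdiff pq]
        constructor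
        · intro h
          have := mul_pos h1 h
          calc (0 : ℝ) < l₁ * ((pq.2 : Fin 2 → ℝ) 0 - (pq.1 : Fin 2 → ℝ) 0 +
              l₂ / l₁ * ((pq.2 : Fin 2 → ℝ) 1 - (pq.1 : Fin 2 → ℝ) 1)) := this
            _ = _ := by field_simp
        · intro h
          have := div_pos h h1
          calc (0 : ℝ) < (l₁ * ((pq.2 : Fin 2 → ℝ) 0 - (pq.1 : Fin 2 → ℝ) 0) +
              l₂ * ((pq.2 : Fin 2 → ℝ) 1 - (pq.1 : Fin 2 → ℝ) 1)) / l₁ := this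
            _ = _ := by field_simp
      by_cases hc : l pq.1 < l pq.2
      · have hpos := key.mpr hc
        simp [hc, sign_pos hpos]
      · have hnpos : ¬ (0 : ℝ) < _ := fun h => hc (key.mp h)
        rcases eq_or_lt_of_le (not_lt.mp hnpos) with h0 | hneg
        · simp [hc, h0]
        · simp [hc, sign_neg hneg]
    · -- l₁ = 0
      right
      refine ⟨SignType.sign l₂, Set.mem_univ _, ?_⟩
      funext pq
      simp only [G, cmpPat]
      have key : l pq.1 < l pq.2 ↔ 0 < l₂ * ((pq.2 : Fin 2 → ℝ) 1 - (pq.1 : Fin 2 → ℝ) 1) := by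
        rw [← sub_pos (a := l pq.2), hdiff pq, ← h1]; simp
      rw [← sign_mul]
      by_cases hc : l pq.1 < l pq.2
      · simp [hc, sign_pos (key.mp hc)]
      · have hnpos : ¬ (0 : ℝ) < _ := fun h => hc (key.mpr h)
        rcases eq_or_lt_of_le (not_lt.mp hnpos) with h0 | hneg
        · simp [hc, h0]
        · simp [hc, sign_neg hneg]
    · -- l₁ < 0
      left; right
      refine ⟨signVec D (l₂ / l₁), ⟨l₂ / l₁, rfl⟩, ?_⟩
      funext pq
      simp only [Fm, cmpPat, signVec, dv]
      have hne : l₁ ≠ 0 := h1.ne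
      have key : ((pq.2 : Fin 2 → ℝ) 0 - (pq.1 : Fin 2 → ℝ) 0) +
          l₂ / l₁ * ((pq.2 : Fin 2 → ℝ) 1 - (pq.1 : Fin 2 → ℝ) 1) < 0 ↔ l pq.1 < l pq.2 := by
        rw [← sub_pos (a := l pq.2), hdiff pq]
        constructor
        · intro h
          have := mul_pos_of_neg_of_neg h1 h
          calc (0 : ℝ) < l₁ * ((pq.2 : Fin 2 → ℝ) 0 - (pq.1 : Fin 2 → ℝ) 0 +
              l₂ / l₁ * ((pq.2 : Fin 2 → ℝ) 1 - (pq.1 : Fin 2 → ℝ) 1)) := this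
            _ = _ := by field_simp
        · intro h
          have := div_neg_of_pos_of_neg h h1
          calc ((pq.2 : Fin 2 → ℝ) 0 - (pq.1 : Fin 2 → ℝ) 0) +
              l₂ / l₁ * ((pq.2 : Fin 2 → ℝ) 1 - (pq.1 : Fin 2 → ℝ) 1)
              = (l₁ * ((pq.2 : Fin 2 → ℝ) 0 - (pq.1 : Fin 2 → ℝ) 0) +
                l₂ * ((pq.2 : Fin 2 → ℝ) 1 - (pq.1 : Fin 2 → ℝ) 1)) / l₁ := by
                field_simp
            _ < 0 := this
      by_cases hc : l pq.1 < l pq.2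
      · have hneg := key.mpr hc
        simp [hc, sign_neg hneg]
      · have hnneg : ¬ _ < (0 : ℝ) := fun h => hc (key.mp h)
        rcases eq_or_lt_of_le (not_lt.mp hnneg) with h0 | hpos
        · simp [hc, ← h0]
        · simp [hc, sign_pos hpos]
  have hSVfin : (Set.range (signVec D)).Finite := Set.toFinite _
  have hSV := ncard_range_signVec_le D
  have hDcard : D.card ≤ P.card * P.card := card_diffSet_le P
  have hG : (G '' Set.univ).ncard ≤ 3 := by
    calc (G '' Set.univ).ncard ≤ (Set.univ : Set SignType).ncard :=
          Set.ncard_image_le (Set.toFinite _)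
      _ = 3 := by rw [Set.ncard_univ, Nat.card_eq_fintype_card]; rfl
  calc (Set.range (cmpPat P)).ncard
      ≤ ((Fp '' Set.range (signVec D) ∪ Fm '' Set.range (signVec D)) ∪ G '' Set.univ).ncard :=
        Set.ncard_le_ncard hcover (Set.toFinite _)
    _ ≤ (Fp '' Set.range (signVec D) ∪ Fm '' Set.range (signVec D)).ncard + (G '' Set.univ).ncard :=
        Set.ncard_union_le _ _
    _ ≤ ((Fp '' Set.range (signVec D)).ncard + (Fm '' Set.range (signVec D)).ncard) +
          (G '' Set.univ).ncard := by gcongr; exact Set.ncard_union_le _ _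
    _ ≤ ((Set.range (signVec D)).ncard + (Set.range (signVec D)).ncard) + 3 := by
        gcongr
        · exact Set.ncard_image_le hSVfin
        · exact Set.ncard_image_le hSVfin
    _ ≤ 4 * (P.card * P.card) + 7 := by omega

end CmpPat


/-! ## §E4  The lexicographic top of a letter set and its invariance under equal comparison patterns -/

section LexTop

/-- Sort key of an exponent under the functional `l`: its `l`-value, ties broken by the exponent itself
(lexicographically on its two coordinates).  Values in the linear order `ℝ ×ₗ (ℕ ×ₗ ℕ)`. -/
noncomputable def lexKey (l : (Fin 2 → ℝ) →L[ℝ] ℝ) (q : Fin 2 →₀ ℕ) : Lex (ℝ × Lex (ℕ × ℕ)) :=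
  toLex (l (emb q), toLex (q 0, q 1))

theorem lexKey_injective (l : (Fin 2 → ℝ) →L[ℝ] ℝ) : Function.Injective (lexKey l) := by
  intro q q' h
  have h2 : (toLex (q 0, q 1) : Lex (ℕ × ℕ)) = toLex (q' 0, q' 1) := congrArg Prod.snd (toLex.injective h)
  have h3 : (q 0, q 1) = (q' 0, q' 1) := toLex.injective h2
  ext i
  fin_cases i
  · exact congrArg Prod.fst h3
  · exact congrArg Prod.snd h3

/-- The `l`-top letter of a nonempty letter set `C` (ties broken by `lexKey`). -/
noncomputable def lexTop (l : (Fin 2 → ℝ) →L[ℝ] ℝ) (C : Finset (Fin 2 →₀ ℕ)) (hC : C.Nonempty) :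
    Fin 2 →₀ ℕ :=
  (Finset.exists_max_image C (lexKey l) hC).choose

theorem lexTop_mem (l : (Fin 2 → ℝ) →L[ℝ] ℝ) (C : Finset (Fin 2 →₀ ℕ)) (hC : C.Nonempty) :
    lexTop l C hC ∈ C :=
  (Finset.exists_max_image C (lexKey l) hC).choose_spec.1

theorem lexKey_le_lexTop (l : (Fin 2 → ℝ) →L[ℝ] ℝ) (C : Finset (Fin 2 →₀ ℕ)) (hC : C.Nonempty)
    {q : Fin 2 →₀ ℕ} (hq : q ∈ C) : lexKey l q ≤ lexKey l (lexTop l C hC) :=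
  (Finset.exists_max_image C (lexKey l) hC).choose_spec.2 q hq

/-- The top letter is `l`-maximal (what blueprint step 3 uses: cube points are `l`-higher). -/
theorem apply_le_apply_lexTop (l : (Fin 2 → ℝ) →L[ℝ] ℝ) (C : Finset (Fin 2 →₀ ℕ)) (hC : C.Nonempty)
    {q : Fin 2 →₀ ℕ} (hq : q ∈ C) : l (emb q) ≤ l (emb (lexTop l C hC)) := by
  have h := lexKey_le_lexTop l C hC hq
  simp only [lexKey, Prod.Lex.le_iff] at h
  rcases h with h | ⟨h, _⟩
  · exact h.le
  · exact h.le

/-- Uniqueness: any `lexKey`-maximal letter of `C` is the top. -/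
theorem eq_lexTop_of_forall_le (l : (Fin 2 → ℝ) →L[ℝ] ℝ) (C : Finset (Fin 2 →₀ ℕ)) (hC : C.Nonempty)
    {q : Fin 2 →₀ ℕ} (hq : q ∈ C) (hmax : ∀ q' ∈ C, lexKey l q' ≤ lexKey l q) :
    q = lexTop l C hC :=
  lexKey_injective l (le_antisymm (lexKey_le_lexTop l C hC hq) (hmax _ (lexTop_mem l C hC)))

/-- **Invariance.** Two functionals that compare the letters of `C` identically have the same top. -/
theorem lexTop_eq_of_cmp_iff (l l' : (Fin 2 → ℝ) →L[ℝ] ℝ) (C : Finset (Fin 2 →₀ ℕ)) (hC : C.Nonempty)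
    (H : ∀ p ∈ C, ∀ q ∈ C, (l (emb p) < l (emb q) ↔ l' (emb p) < l' (emb q))) :
    lexTop l C hC = lexTop l' C hC := by
  apply eq_lexTop_of_forall_le l' C hC (lexTop_mem l C hC)
  intro q hq
  have h := lexKey_le_lexTop l C hC hq
  simp only [lexKey, Prod.Lex.le_iff] at h ⊢
  rcases h with h | ⟨h1, h2⟩
  · exact Or.inl ((H q hq _ (lexTop_mem l C hC)).mp h)
  · right
    refine ⟨?_, h2⟩
    have h1' : l (emb q) = l (emb (lexTop l C hC)) := h1
    have a : ¬ l' (emb q) < l' (emb (lexTop l C hC)) := fun h' => by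
      have := (H q hq _ (lexTop_mem l C hC)).mpr h'
      rw [h1'] at this
      exact lt_irrefl _ this
    have b : ¬ l' (emb (lexTop l C hC)) < l' (emb q) := fun h' => by
      have := (H _ (lexTop_mem l C hC) q hq).mpr h'
      rw [h1'] at this
      exact lt_irrefl _ this
    exact le_antisymm (not_lt.mp b) (not_lt.mp a)

/-- The same, from equality of comparison patterns on any finite `P ⊇ emb '' C` (so, with §E3:
for fixed `C` — and for a fixed tuple of letter sets — the top (tuple) takes `≤ 4|P|² + 7` values as `l`
ranges over all functionals). -/
theorem lexTop_eq_of_cmpPat_eq (P : Finset (Fin 2 → ℝ)) (l l' : (Fin 2 → ℝ) →L[ℝ] ℝ)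
    (hpat : cmpPat P l = cmpPat P l') (C : Finset (Fin 2 →₀ ℕ)) (hC : C.Nonempty)
    (hCP : ∀ q ∈ C, emb q ∈ P) : lexTop l C hC = lexTop l' C hC := by
  apply lexTop_eq_of_cmp_iff
  intro p hp q hq
  have := congrFun hpat (⟨emb p, hCP p hp⟩, ⟨emb q, hCP q hq⟩)
  simpa [cmpPat] using this

/-- Counting form used in blueprint step 4: for a tuple of nonempty letter sets inside `P`, the tuple of
tops, as a function of the functional, factors through `cmpPat P`; hence its range has
`≤ 4|P|² + 7` elements. -/
theorem ncard_range_topTuple_le {m : ℕ} (P : Finset (Fin 2 → ℝ)) (C : Fin m → Finset (Fin 2 →₀ ℕ))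
    (hC : ∀ j, (C j).Nonempty) (hCP : ∀ j, ∀ q ∈ C j, emb q ∈ P) :
    (Set.range (fun l : (Fin 2 → ℝ) →L[ℝ] ℝ => fun j => lexTop l (C j) (hC j))).ncard
      ≤ 4 * (P.card * P.card) + 7 := by
  classical
  set tt := (fun l : (Fin 2 → ℝ) →L[ℝ] ℝ => fun j => lexTop l (C j) (hC j)) with htt
  -- tt factors through cmpPat P
  have hfac : ∀ l l', cmpPat P l = cmpPat P l' → tt l = tt l' := by
    intro l l' h
    funext j
    exact lexTop_eq_of_cmpPat_eq P l l' h (C j) (hC j) (hCP j)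
  -- so range tt is the image of range (cmpPat P) under a function
  have hchoose : ∀ c ∈ Set.range (cmpPat P), ∃ l, cmpPat P l = c := fun c hc => hc
  choose fn hfn using hchoose
  let Φ : (↥P × ↥P → Bool) → (Fin m → (Fin 2 →₀ ℕ)) := fun c =>
    if hc : c ∈ Set.range (cmpPat P) then tt (fn c hc) else fun j => lexTop 0 (C j) (hC j)
  have hsub : Set.range tt ⊆ Φ '' Set.range (cmpPat P) := by
    rintro _ ⟨l, rfl⟩
    refine ⟨cmpPat P l, ⟨l, rfl⟩, ?_⟩
    have hc : cmpPat P l ∈ Set.range (cmpPat P) := ⟨l, rfl⟩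
    simp only [Φ, dif_pos hc]
    exact hfac _ _ (hfn _ hc)
  calc (Set.range tt).ncard ≤ (Φ '' Set.range (cmpPat P)).ncard :=
        Set.ncard_le_ncard hsub (Set.toFinite _)
    _ ≤ (Set.range (cmpPat P)).ncard := Set.ncard_image_le (Set.toFinite _)
    _ ≤ 4 * (P.card * P.card) + 7 := ncard_range_cmpPat_le P

end LexTop



/-! ## §F  FULL PROOF OF THE CRUX (candidate, for a prover to land): assembly of §A and §E -/

section Assembly

open MvPolynomial

variable {k m : ℕ}

/-- `emb` is additive over finite sums. -/
theorem emb_sum (a : Fin m → (Fin 2 →₀ ℕ)) : emb (∑ j, a j) = ∑ j, emb (a j) := by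
  funext i
  simp [emb, Finset.sum_apply]

/-- Total version of `lexTop` (junk value `0` on the empty set). -/
noncomputable def lexTop' (l : (Fin 2 → ℝ) →L[ℝ] ℝ) (C : Finset (Fin 2 →₀ ℕ)) : Fin 2 →₀ ℕ :=
  if h : C.Nonempty then lexTop l C h else 0

/-- On a nonempty set `lexTop'` is `lexTop`. -/
theorem lexTop'_eq (l : (Fin 2 → ℝ) →L[ℝ] ℝ) (C : Finset (Fin 2 →₀ ℕ)) (h : C.Nonempty) :
    lexTop' l C = lexTop l C h := dif_pos h

/-- Invariance of `lexTop'` under equal comparison patterns. -/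
theorem lexTop'_eq_of_cmpPat_eq (P : Finset (Fin 2 → ℝ)) (l l' : (Fin 2 → ℝ) →L[ℝ] ℝ)
    (hpat : cmpPat P l = cmpPat P l') (C : Finset (Fin 2 →₀ ℕ)) (hCP : ∀ q ∈ C, emb q ∈ P) :
    lexTop' l C = lexTop' l' C := by
  by_cases h : C.Nonempty
  · rw [lexTop'_eq l C h, lexTop'_eq l' C h]
    exact lexTop_eq_of_cmpPat_eq P l l' hpat C h hCP
  · simp [lexTop', h]

/-- The letters of coordinate `j` at which every product of `I` is alive. -/
noncomputable def aliveLetters (A : Fin m → Finset (Fin 2 →₀ ℕ))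
    (f : Fin k → Fin m → MvPolynomial (Fin 2) ℂ) (I : Finset (Fin k)) (j : Fin m) :
    Finset (Fin 2 →₀ ℕ) := by
  classical
  exact (A j).filter (fun e => ∀ i ∈ I, coeff e (f i j) ≠ 0)

theorem mem_aliveLetters (A : Fin m → Finset (Fin 2 →₀ ℕ))
    (f : Fin k → Fin m → MvPolynomial (Fin 2) ℂ) (I : Finset (Fin k)) (j : Fin m) (e : Fin 2 →₀ ℕ) :
    e ∈ aliveLetters A f I j ↔ e ∈ A j ∧ ∀ i ∈ I, coeff e (f i j) ≠ 0 := by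
  classical
  simp [aliveLetters, Finset.mem_filter]

/-- The box-top tuple of the alive stratum `I` under the functional `l`. -/
noncomputable def topTuple (A : Fin m → Finset (Fin 2 →₀ ℕ))
    (f : Fin k → Fin m → MvPolynomial (Fin 2) ℂ) (I : Finset (Fin k))
    (l : (Fin 2 → ℝ) →L[ℝ] ℝ) : Fin m → (Fin 2 →₀ ℕ) :=
  fun j => lexTop' l (aliveLetters A f I j)

/-- Top tuples have letters in `A j` or the junk `0`. -/
theorem topTuple_mem_insert (A : Fin m → Finset (Fin 2 →₀ ℕ))
    (f : Fin k → Fin m → MvPolynomial (Fin 2) ℂ) (I : Finset (Fin k))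
    (l : (Fin 2 → ℝ) →L[ℝ] ℝ) (j : Fin m) : topTuple A f I l j ∈ insert 0 (A j) := by
  simp only [topTuple, lexTop']
  split
  · next h =>
    exact Finset.mem_insert_of_mem ((mem_aliveLetters A f I j _).mp (lexTop_mem l _ h)).1
  · exact Finset.mem_insert_self _ _

/-- All letters, embedded: the finite planar set on which comparison patterns are read. -/
noncomputable def allPts (A : Fin m → Finset (Fin 2 →₀ ℕ)) : Finset (Fin 2 → ℝ) :=
  (Finset.univ.biUnion A).image emb

/-- `#allPts ≤ m t`. -/
theorem card_allPts_le (A : Fin m → Finset (Fin 2 →₀ ℕ)) (t : ℕ) (hA : ∀ j, (A j).card ≤ t) :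
    (allPts A).card ≤ m * t := by
  refine Finset.card_image_le.trans ?_
  refine Finset.card_biUnion_le.trans ?_
  calc ∑ j, (A j).card ≤ ∑ _j : Fin m, t := Finset.sum_le_sum (fun j _ => hA j)
    _ = m * t := by simp

/-- The top tuples of a fixed stratum take few values (blueprint step 4). -/
theorem ncard_range_topTuple_le' (A : Fin m → Finset (Fin 2 →₀ ℕ))
    (f : Fin k → Fin m → MvPolynomial (Fin 2) ℂ) (I : Finset (Fin k)) :
    (Set.range (topTuple A f I)).ncard ≤ 4 * ((allPts A).card * (allPts A).card) + 7 := by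
  classical
  set P := allPts A with hP
  have hCP : ∀ j, ∀ q ∈ aliveLetters A f I j, emb q ∈ P := by
    intro j q hq
    refine Finset.mem_image.mpr ⟨q, ?_, rfl⟩
    exact Finset.mem_biUnion.mpr ⟨j, Finset.mem_univ _, ((mem_aliveLetters A f I j q).mp hq).1⟩
  have hfac : ∀ l l', cmpPat P l = cmpPat P l' → topTuple A f I l = topTuple A f I l' := by
    intro l l' h
    funext j
    exact lexTop'_eq_of_cmpPat_eq P l l' h _ (hCP j)
  have hchoose : ∀ c ∈ Set.range (cmpPat P), ∃ l, cmpPat P l = c := fun c hc => hc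
  choose fn hfn using hchoose
  let Φ : (↥P × ↥P → Bool) → (Fin m → (Fin 2 →₀ ℕ)) := fun c =>
    if hc : c ∈ Set.range (cmpPat P) then topTuple A f I (fn c hc) else fun _ => 0
  have hsub : Set.range (topTuple A f I) ⊆ Φ '' Set.range (cmpPat P) := by
    rintro _ ⟨l, rfl⟩
    have hc : cmpPat P l ∈ Set.range (cmpPat P) := ⟨l, rfl⟩
    refine ⟨cmpPat P l, hc, ?_⟩
    simp only [Φ, dif_pos hc]
    exact hfac _ _ (hfn _ hc)
  calc (Set.range (topTuple A f I)).ncard ≤ (Φ '' Set.range (cmpPat P)).ncard :=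
        Set.ncard_le_ncard hsub (Set.toFinite _)
    _ ≤ (Set.range (cmpPat P)).ncard := Set.ncard_image_le (Set.toFinite _)
    _ ≤ 4 * (P.card * P.card) + 7 := ncard_range_cmpPat_le P

/-- The tensor `T(a) = Σ_i Π_j coeff (a j) (f i j)`. -/
noncomputable def tensorVal (f : Fin k → Fin m → MvPolynomial (Fin 2) ℂ)
    (a : Fin m → (Fin 2 →₀ ℕ)) : ℂ :=
  ∑ i, ∏ j, coeff (a j) (f i j)

/-- Number of coordinates in which two words differ. -/
noncomputable def diffCard (a c : Fin m → (Fin 2 →₀ ℕ)) : ℕ :=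
  (Finset.univ.filter (fun j => a j ≠ c j)).card

/-- **Thickness lemma (blueprint step 3).**  Every extreme point of the Newton polygon is `emb (Σ_j a_j)`
for a grid word `a` that differs from the box top of its own alive stratum (for a suitable
functional) in at most `k - 1` coordinates. -/
theorem thickness_le (A : Fin m → Finset (Fin 2 →₀ ℕ)) (f : Fin k → Fin m → MvPolynomial (Fin 2) ℂ)
    (hsupp : ∀ i j, (f i j).support ⊆ A j)
    (hinj : ∀ a b : Fin m → (Fin 2 →₀ ℕ), (∀ j, a j ∈ A j) → (∀ j, b j ∈ A j) →
      ∑ j, a j = ∑ j, b j → a = b)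
    {p : Fin 2 → ℝ}
    (hp : p ∈ Set.extremePoints ℝ (convexHull ℝ
      (emb '' ((∑ i, ∏ j, f i j).support : Set (Fin 2 →₀ ℕ))))) :
    ∃ (a : Fin m → (Fin 2 →₀ ℕ)) (I : Finset (Fin k)) (l : (Fin 2 → ℝ) →L[ℝ] ℝ),
      (∀ j, a j ∈ A j) ∧ emb (∑ j, a j) = p ∧ (∀ j, topTuple A f I l j ∈ A j) ∧
      diffCard a (topTuple A f I l) + 1 ≤ k := by
  classical
  set F := ∑ i, ∏ j, f i j with hF
  set S : Set (Fin 2 → ℝ) := emb '' (F.support : Set (Fin 2 →₀ ℕ)) with hS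
  have hSfin : S.Finite := (Finset.finite_toSet _).image _
  obtain ⟨e, he, hep⟩ := (extremePoints_convexHull_subset hp : p ∈ S)
  subst hep
  obtain ⟨a, ha, hae, hTa⟩ := exists_word_of_mem_support A f hsupp hinj he
  obtain ⟨l, hl⟩ := exists_strict_sep_of_mem_extremePoints_convexHull hSfin hp
  set I : Finset (Fin k) := Finset.univ.filter (fun i => ∀ j, coeff (a j) (f i j) ≠ 0) with hI
  have haC : ∀ j, a j ∈ aliveLetters A f I j := by
    intro j
    refine (mem_aliveLetters A f I j _).mpr ⟨ha j, ?_⟩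
    intro i hi
    exact (Finset.mem_filter.mp hi).2 j
  have hCne : ∀ j, (aliveLetters A f I j).Nonempty := fun j => ⟨a j, haC j⟩
  set b := topTuple A f I l with hb
  have hbj : ∀ j, b j = lexTop l (aliveLetters A f I j) (hCne j) := fun j => lexTop'_eq _ _ _
  have hbmem : ∀ j, b j ∈ aliveLetters A f I j := fun j => by rw [hbj]; exact lexTop_mem _ _ _
  have hbA : ∀ j, b j ∈ A j := fun j => ((mem_aliveLetters A f I j _).mp (hbmem j)).1
  have hbl : ∀ j, l (emb (a j)) ≤ l (emb (b j)) := fun j => by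
    rw [hbj]; exact apply_le_apply_lexTop _ _ _ (haC j)
  refine ⟨a, I, l, ha, by rw [hae], hbA, ?_⟩
  -- the cube between `b` (false) and `a` (true) on the coordinates where they differ
  set Jp : Finset (Fin m) := Finset.univ.filter (fun j => a j ≠ b j) with hJp
  set word : (↥Jp → Bool) → (Fin m → (Fin 2 →₀ ℕ)) :=
    fun ε j => if h : j ∈ Jp then (if ε ⟨j, h⟩ then a j else b j) else a j with hword
  have word_mem : ∀ ε j, word ε j ∈ A j := by
    intro ε j
    simp only [hword]
    split
    · split
      · exact ha j
      · exact hbA j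
    · exact ha j
  set x : Fin k → ℂ := fun i => ∏ j ∈ Jpᶜ, coeff (a j) (f i j) with hx
  set v : Fin k → ↥Jp → Bool → ℂ := fun i j bb => coeff (if bb then a j else b j) (f i j) with hv
  have hsplit : ∀ (ε : ↥Jp → Bool) (i : Fin k),
      x i * ∏ j, v i j (ε j) = ∏ j, coeff (word ε j) (f i j) := by
    intro ε i
    have hA' : ∏ j ∈ Jpᶜ, coeff (a j) (f i j) = ∏ j ∈ Jpᶜ, coeff (word ε j) (f i j) := by
      apply Finset.prod_congr rfl
      intro j hj
      have : j ∉ Jp := Finset.mem_compl.mp hj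
      simp [hword, this]
    have hB' : (∏ j : ↥Jp, v i j (ε j)) = ∏ j ∈ Jp, coeff (word ε j) (f i j) := by
      rw [← Finset.prod_coe_sort Jp (fun j => coeff (word ε j) (f i j))]
      apply Finset.prod_congr rfl
      intro j _
      have hj : (j : Fin m) ∈ Jp := j.2
      simp [hv, hword, hj]
    simp only [hx]
    rw [hA', hB', mul_comm, Finset.prod_mul_prod_compl]
  have hT : ∀ ε : ↥Jp → Bool, (∑ i, x i * ∏ j, v i j (ε j)) = tensorVal f (word ε) := by
    intro ε
    simp only [tensorVal]
    exact Finset.sum_congr rfl (fun i _ => hsplit ε i)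
  have word_true : word (fun _ => true) = a := by
    funext j
    simp [hword]
  have h1 : (∑ i, x i * ∏ j, v i j true) = tensorVal f a := by
    have := hT (fun _ => true)
    rw [word_true] at this
    exact this
  have hTa' : tensorVal f a ≠ 0 := hTa
  have h0 : ∀ ε : ↥Jp → Bool, (∃ j, ε j = false) → (∑ i, x i * ∏ j, v i j (ε j)) = 0 := by
    rintro ε ⟨j₀, hj₀⟩
    rw [hT ε]
    by_contra hne
    have hcoeff : coeff (∑ j, word ε j) F = tensorVal f (word ε) :=
      coeff_sum_prod_of_dissociated A f hsupp hinj (word ε) (word_mem ε)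
    have hmemS : emb (∑ j, word ε j) ∈ S := by
      refine ⟨∑ j, word ε j, ?_, rfl⟩
      rw [Finset.mem_coe, mem_support_iff, hcoeff]
      exact hne
    have hj₀J : (j₀ : Fin m) ∈ Jp := j₀.2
    have haneb : a j₀ ≠ b j₀ := (Finset.mem_filter.mp hj₀J).2
    have hneq : emb (∑ j, word ε j) ≠ emb e := by
      intro h
      have h' := emb_injective h
      rw [← hae] at h'
      have hw := hinj _ _ (word_mem ε) ha h'
      have hwj := congrFun hw j₀
      simp only [hword, dif_pos hj₀J] at hwj
      rw [show (⟨(j₀ : Fin m), hj₀J⟩ : ↥Jp) = j₀ from rfl, hj₀] at hwj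
      simp only [Bool.false_eq_true, ↓reduceIte] at hwj
      exact haneb hwj.symm
    have hlt := hl _ hmemS hneq
    have hge : l (emb e) ≤ l (emb (∑ j, word ε j)) := by
      rw [← hae, emb_sum, emb_sum, map_sum, map_sum]
      apply Finset.sum_le_sum
      intro j _
      by_cases hj : j ∈ Jp
      · simp only [hword, dif_pos hj]
        split
        · exact le_rfl
        · exact hbl j
      · simp [hword, hj]
    exact absurd hlt (not_lt.mpr hge)
  have htri : ∀ i, x i ≠ 0 → (∀ j, v i j false ≠ 0) ∨ (∃ j, v i j true = 0) := by
    intro i hxi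
    by_cases hi : ∀ j, coeff (a j) (f i j) ≠ 0
    · left
      intro j
      have hiI : i ∈ I := Finset.mem_filter.mpr ⟨Finset.mem_univ _, hi⟩
      have := ((mem_aliveLetters A f I j _).mp (hbmem j)).2 i hiI
      simpa [hv] using this
    · push Not at hi
      obtain ⟨j, hj⟩ := hi
      by_cases hjJ : j ∈ Jp
      · right
        exact ⟨⟨j, hjJ⟩, by simpa [hv] using hj⟩
      · exfalso
        apply hxi
        simp only [hx]
        exact Finset.prod_eq_zero (Finset.mem_compl.mpr hjJ) hj
  obtain ⟨s, _, hcard⟩ := mixed_cube_lemma x v (tensorVal f a) hTa' h1 h0 htri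
  have hsk : s.card ≤ k := (Finset.card_le_univ s).trans (by simp)
  rw [Fintype.card_coe] at hcard
  show Jp.card + 1 ≤ k
  omega

/-- Hamming ball of radius `r` around `c` inside the grid `Π_j A_j`. -/
noncomputable def ball (A : Fin m → Finset (Fin 2 →₀ ℕ)) (c : Fin m → (Fin 2 →₀ ℕ)) (r : ℕ) :
    Finset (Fin m → (Fin 2 →₀ ℕ)) :=
  (Fintype.piFinset A).filter (fun w => diffCard w c ≤ r)

/-- `|ball(c, r)| ≤ (mt+1)^r` for a centre in the grid. -/
theorem card_ball_le (A : Fin m → Finset (Fin 2 →₀ ℕ)) (t : ℕ) (hA : ∀ j, (A j).card ≤ t)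
    (c : Fin m → (Fin 2 →₀ ℕ)) (hc : ∀ j, c j ∈ A j) :
    ∀ r : ℕ, (ball A c r).card ≤ (m * t + 1) ^ r := by
  classical
  intro r
  induction r with
  | zero =>
    have hsub : ball A c 0 ⊆ {c} := by
      intro w hw
      rw [Finset.mem_singleton]
      have hw' : diffCard w c ≤ 0 := (Finset.mem_filter.mp hw).2
      funext j
      by_contra hne
      have hj : j ∈ Finset.univ.filter (fun j => w j ≠ c j) :=
        Finset.mem_filter.mpr ⟨Finset.mem_univ _, hne⟩
      have : 0 < diffCard w c := Finset.card_pos.mpr ⟨j, hj⟩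
      omega
    calc (ball A c 0).card ≤ ({c} : Finset _).card := Finset.card_le_card hsub
      _ = (m * t + 1) ^ 0 := by simp
  | succ r ih =>
    set U := Finset.univ.biUnion (fun j => (A j).biUnion (fun e =>
          (ball A c r).image (fun w => Function.update w j e))) with hU
    have hcover : ball A c (r + 1) ⊆ ball A c r ∪ U := by
      intro w hw
      obtain ⟨hwA, hwcard⟩ := Finset.mem_filter.mp hw
      by_cases hle : diffCard w c ≤ r
      · exact Finset.mem_union_left _ (Finset.mem_filter.mpr ⟨hwA, hle⟩)
      · have hne : (Finset.univ.filter (fun j => w j ≠ c j)).Nonempty := by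
          rw [← Finset.card_pos]; change 0 < diffCard w c; omega
        obtain ⟨j, hj⟩ := hne
        apply Finset.mem_union_right
        simp only [hU, Finset.mem_biUnion, Finset.mem_univ, true_and, Finset.mem_image]
        refine ⟨j, w j, Fintype.mem_piFinset.mp hwA j, Function.update w j (c j), ?_, ?_⟩
        · refine Finset.mem_filter.mpr ⟨?_, ?_⟩
          · refine Fintype.mem_piFinset.mpr (fun j' => ?_)
            by_cases h : j' = j
            · subst h; simp [hc]
            · rw [Function.update_of_ne h]; exact Fintype.mem_piFinset.mp hwA j'
          · have heq : Finset.univ.filter (fun j' => Function.update w j (c j) j' ≠ c j') =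
                (Finset.univ.filter (fun j' => w j' ≠ c j')).erase j := by
              ext j'
              by_cases h : j' = j
              · subst h; simp
              · simp [h]
            change (Finset.univ.filter (fun j' => Function.update w j (c j) j' ≠ c j')).card ≤ r
            rw [heq, Finset.card_erase_of_mem hj]
            change diffCard w c - 1 ≤ r
            change diffCard w c ≤ r + 1 at hwcard
            omega
        · funext j'
          by_cases h : j' = j
          · subst h; simp
          · simp [Function.update_of_ne h]
    have hUcard : U.card ≤ m * t * (ball A c r).card := by
      calc U.card ≤ ∑ j, ((A j).biUnion (fun e =>
            (ball A c r).image (fun w => Function.update w j e))).card := Finset.card_biUnion_le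
        _ ≤ ∑ j, ∑ e ∈ A j, ((ball A c r).image (fun w => Function.update w j e)).card :=
            Finset.sum_le_sum (fun j _ => Finset.card_biUnion_le)
        _ ≤ ∑ j, ∑ _e ∈ A j, (ball A c r).card :=
            Finset.sum_le_sum (fun j _ => Finset.sum_le_sum (fun e _ => Finset.card_image_le))
        _ = ∑ j, (A j).card * (ball A c r).card := by simp [Finset.sum_const, smul_eq_mul]
        _ ≤ ∑ _j : Fin m, t * (ball A c r).card :=
            Finset.sum_le_sum (fun j _ => Nat.mul_le_mul_right _ (hA j))
        _ = m * t * (ball A c r).card := by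
            simp [Finset.sum_const, Finset.card_univ, Fintype.card_fin]; ring
    calc (ball A c (r + 1)).card ≤ (ball A c r ∪ U).card := Finset.card_le_card hcover
      _ ≤ (ball A c r).card + U.card := Finset.card_union_le _ _
      _ ≤ (ball A c r).card + m * t * (ball A c r).card := Nat.add_le_add_left hUcard _
      _ = (m * t + 1) * (ball A c r).card := by ring
      _ ≤ (m * t + 1) * (m * t + 1) ^ r := Nat.mul_le_mul_left _ ih
      _ = (m * t + 1) ^ (r + 1) := by ring

/-- **The explicit bound** (blueprint steps 1–4 assembled):
`#vertices ≤ 2^k · (4(mt)² + 7) · (mt+1)^{k-1}`. -/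
theorem vertices_le (k m t : ℕ) (A : Fin m → Finset (Fin 2 →₀ ℕ))
    (f : Fin k → Fin m → MvPolynomial (Fin 2) ℂ) (hA : ∀ j, (A j).card ≤ t)
    (hsupp : ∀ i j, (f i j).support ⊆ A j)
    (hinj : ∀ a b : Fin m → (Fin 2 →₀ ℕ), (∀ j, a j ∈ A j) → (∀ j, b j ∈ A j) →
      ∑ j, a j = ∑ j, b j → a = b) :
    (Set.extremePoints ℝ (convexHull ℝ
      (emb '' ((∑ i, ∏ j, f i j).support : Set (Fin 2 →₀ ℕ))))).ncard
      ≤ 2 ^ k * (4 * ((m * t) * (m * t)) + 7) * (m * t + 1) ^ (k - 1) := by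
  classical
  set EP := Set.extremePoints ℝ (convexHull ℝ
    (emb '' ((∑ i, ∏ j, f i j).support : Set (Fin 2 →₀ ℕ)))) with hEP
  -- centres: top tuples lying in the grid, per stratum
  let Cen : Finset (Fin k) → Finset (Fin m → (Fin 2 →₀ ℕ)) := fun I =>
    (Fintype.piFinset A).filter (fun c => c ∈ Set.range (topTuple A f I))
  have hCen : ∀ I, (Cen I).card ≤ 4 * ((m * t) * (m * t)) + 7 := by
    intro I
    have hfin : (Set.range (topTuple A f I)).Finite := by
      refine Set.Finite.subset (Finset.finite_toSet (Fintype.piFinset (fun j => insert 0 (A j)))) ?_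
      rintro _ ⟨l, rfl⟩
      exact Finset.mem_coe.mpr (Fintype.mem_piFinset.mpr (fun j => topTuple_mem_insert A f I l j))
    have hP := card_allPts_le A t hA
    have hP2 : (allPts A).card * (allPts A).card ≤ (m * t) * (m * t) := Nat.mul_le_mul hP hP
    calc (Cen I).card = ((Cen I : Finset (Fin m → (Fin 2 →₀ ℕ))) : Set (Fin m → (Fin 2 →₀ ℕ))).ncard :=
          (Set.ncard_coe_finset _).symm
      _ ≤ (Set.range (topTuple A f I)).ncard := by
          refine Set.ncard_le_ncard ?_ hfin
          intro c hc
          rw [Finset.mem_coe] at hc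
          exact (Finset.mem_filter.mp hc).2
      _ ≤ 4 * ((allPts A).card * (allPts A).card) + 7 := ncard_range_topTuple_le' A f I
      _ ≤ 4 * ((m * t) * (m * t)) + 7 := by omega
  let Cand : Finset (Fin m → (Fin 2 →₀ ℕ)) :=
    (Finset.univ : Finset (Finset (Fin k))).biUnion
      (fun I => (Cen I).biUnion (fun c => ball A c (k - 1)))
  have hCand : Cand.card ≤ 2 ^ k * (4 * ((m * t) * (m * t)) + 7) * (m * t + 1) ^ (k - 1) := by
    calc Cand.card ≤ ∑ I : Finset (Fin k), ((Cen I).biUnion (fun c => ball A c (k - 1))).card :=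
          Finset.card_biUnion_le
      _ ≤ ∑ I : Finset (Fin k), ∑ c ∈ Cen I, (ball A c (k - 1)).card :=
          Finset.sum_le_sum (fun I _ => Finset.card_biUnion_le)
      _ ≤ ∑ I : Finset (Fin k), ∑ _c ∈ Cen I, (m * t + 1) ^ (k - 1) := by
          refine Finset.sum_le_sum (fun I _ => Finset.sum_le_sum (fun c hc => ?_))
          exact card_ball_le A t hA c (Fintype.mem_piFinset.mp (Finset.mem_filter.mp hc).1) _
      _ ≤ ∑ _I : Finset (Fin k), (4 * ((m * t) * (m * t)) + 7) * (m * t + 1) ^ (k - 1) := by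
          refine Finset.sum_le_sum (fun I _ => ?_)
          rw [Finset.sum_const, smul_eq_mul]
          exact Nat.mul_le_mul_right _ (hCen I)
      _ = 2 ^ k * (4 * ((m * t) * (m * t)) + 7) * (m * t + 1) ^ (k - 1) := by
          rw [Finset.sum_const, Finset.card_univ, Fintype.card_finset, Fintype.card_fin,
            smul_eq_mul]
          ring
  -- the injection p ↦ a_p
  have hwit : ∀ p ∈ EP, ∃ a : Fin m → (Fin 2 →₀ ℕ), emb (∑ j, a j) = p ∧ a ∈ Cand := by
    intro p hp
    obtain ⟨a, I, l, ha, hap, htopA, hcard⟩ := thickness_le A f hsupp hinj hp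
    refine ⟨a, hap, ?_⟩
    simp only [Cand, Finset.mem_biUnion, Finset.mem_univ, true_and]
    refine ⟨I, topTuple A f I l, ?_, ?_⟩
    · exact Finset.mem_filter.mpr ⟨Fintype.mem_piFinset.mpr htopA, ⟨l, rfl⟩⟩
    · refine Finset.mem_filter.mpr ⟨Fintype.mem_piFinset.mpr ha, ?_⟩
      omega
  choose! wd hwd using hwit
  calc EP.ncard ≤ ((Cand : Finset (Fin m → (Fin 2 →₀ ℕ))) : Set (Fin m → (Fin 2 →₀ ℕ))).ncard := by
        refine Set.ncard_le_ncard_of_injOn wd (fun p hp => Finset.mem_coe.mpr (hwd p hp).2) ?_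
        intro p hp q hq h
        rw [← (hwd p hp).1, ← (hwd q hq).1, h]
    _ = Cand.card := Set.ncard_coe_finset _
    _ ≤ _ := hCand

/-- Arithmetic: the explicit bound is `≤ (mt+2)^{2k+3}`. -/
theorem bound_le_pow (k u : ℕ) :
    2 ^ k * (4 * (u * u) + 7) * (u + 1) ^ (k - 1) ≤ (u + 2) ^ (2 * k + 3) := by
  have h1 : 2 ^ k ≤ (u + 2) ^ k := Nat.pow_le_pow_left (by omega) k
  have h2 : 4 * (u * u) + 7 ≤ (u + 2) ^ 3 := by
    have e : (u + 2) ^ 3 = u * u * u + 6 * (u * u) + 12 * u + 8 := by ring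
    rw [e]
    have := Nat.zero_le (u * u * u)
    have := Nat.zero_le u
    omega
  have h3 : (u + 1) ^ (k - 1) ≤ (u + 2) ^ (k - 1) := Nat.pow_le_pow_left (by omega) _
  have h4 : (u + 2) ^ k * (u + 2) ^ 3 * (u + 2) ^ (k - 1) = (u + 2) ^ (k + 3 + (k - 1)) := by
    rw [← pow_add, ← pow_add]
  have h5 : (u + 2) ^ (k + 3 + (k - 1)) ≤ (u + 2) ^ (2 * k + 3) :=
    Nat.pow_le_pow_right (by omega) (by omega)
  calc 2 ^ k * (4 * (u * u) + 7) * (u + 1) ^ (k - 1)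
      ≤ (u + 2) ^ k * (u + 2) ^ 3 * (u + 2) ^ (k - 1) := Nat.mul_le_mul (Nat.mul_le_mul h1 h2) h3
    _ = (u + 2) ^ (k + 3 + (k - 1)) := h4
    _ ≤ (u + 2) ^ (2 * k + 3) := h5

/-- **`DissociatedFixedK` holds**, with `C = 2k + 3` (candidate proof; a prover lands it under
`Theorems/`).  Steps: §E1 coefficient formula, §E0 strict exposure, §A mixed cube lemma (thickness
`≤ k-1`), §E2–§E4 sweep counting, Hamming-ball count (`card_ball_le`). -/
theorem dissociatedFixedK_holds :
    Summit.ValiantsHypothesis.ValiantsHypothesis.Theses.NewtonUnitEquations.DissociatedFixedK := by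
  intro k
  refine ⟨2 * k + 3, ?_⟩
  intro m t A f hA hsupp hinj
  have h := vertices_le k m t A f hA hsupp hinj
  rw [show (fun e : Fin 2 →₀ ℕ => fun i : Fin 2 => ((e i : ℕ) : ℝ)) = emb from rfl]
  exact h.trans (bound_le_pow k (m * t))

end Assembly


/-- Sanity: the crux is literally `DissociatedFixedKUniformC` with `∃ C` moved inside `∀ k`, and the
three `Without` variants each delete exactly one hypothesis (all by `Iff.rfl`-level unfolding). -/
theorem dissociatedFixedK_iff :
    Summit.ValiantsHypothesis.ValiantsHypothesis.Theses.NewtonUnitEquations.DissociatedFixedK ↔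
    ∀ k : ℕ, ∃ C : ℕ, ∀ (m t : ℕ) (A : Fin m → Finset (Fin 2 →₀ ℕ))
      (f : Fin k → Fin m → MvPolynomial (Fin 2) ℂ),
      (∀ j, (A j).card ≤ t) → (∀ i j, (f i j).support ⊆ A j) →
      (∀ a b : Fin m → (Fin 2 →₀ ℕ), (∀ j, a j ∈ A j) → (∀ j, b j ∈ A j) → ∑ j, a j = ∑ j, b j → a = b) →
      (Set.extremePoints ℝ (convexHull ℝ ((fun e : Fin 2 →₀ ℕ => fun i : Fin 2 => ((e i : ℕ) : ℝ)) ''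
        ((∑ i, ∏ j, f i j).support : Set (Fin 2 →₀ ℕ))))).ncard ≤ (m * t + 2) ^ C :=
  Iff.rfl

/-- The uniform version trivially implies the crux (so its refutation does not touch the crux). -/
theorem dissociatedFixedK_of_uniformC (h : DissociatedFixedKUniformC) :
    Summit.ValiantsHypothesis.ValiantsHypothesis.Theses.NewtonUnitEquations.DissociatedFixedK := by
  obtain ⟨C, hC⟩ := h
  exact fun k => ⟨C, fun m t A f h1 h2 h3 => hC k m t A f h1 h2 h3⟩



/-! ## §G  (gen 2) `k = 2`: the exponent `C = 1` is FALSE; two products give `4m - 6 = kmt - 6` vertices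

Binomial-pencil certificate machinery + the hyperbola family (mirrors the Negative-lane proposal
`Theorems/DissociatedFixedK/Negative/KTwoExponent.lean`; here self-contained on §B0/§E1).  Summary:
`two_products_many_vertices` (∀ m ≥ 4, a dissociated `t = 2` frame and two products of binomials with
`≥ 4m - 6` vertices), `not_dissociatedFixedKTwoExpOne` (`C(2) ≥ 2`).  See the module docblock §G bullet. -/


open Finset MvPolynomial

section Pencil

variable {m : ℕ} (gen : Fin m → ℕ × ℕ) (u v : Fin 2 → Fin m → ℤ)

/-- Generator `j` as an exponent vector `(x_j, y_j) ∈ ℕ²`. -/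
noncomputable def dvec (j : Fin m) : Fin 2 →₀ ℕ :=
  Finsupp.equivFunOnFinite.symm ![(gen j).1, (gen j).2]

@[simp] theorem dvec_apply_zero (j : Fin m) : dvec gen j 0 = (gen j).1 := by
  simp [dvec]

@[simp] theorem dvec_apply_one (j : Fin m) : dvec gen j 1 = (gen j).2 := by
  simp [dvec]

/-- The binomial frame `A j = {0, d_j}`. -/
noncomputable def frame (j : Fin m) : Finset (Fin 2 →₀ ℕ) := {0, dvec gen j}

theorem card_frame_le (j : Fin m) : (frame gen j).card ≤ 2 := Finset.card_le_two

/-- Factor `j` of product `i`: `u_ij + v_ij X^{d_j}` (integer coefficients). -/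
noncomputable def fac (i : Fin 2) (j : Fin m) : MvPolynomial (Fin 2) ℂ :=
  monomial 0 ((u i j : ℤ) : ℂ) + monomial (dvec gen j) ((v i j : ℤ) : ℂ)

theorem support_fac_subset (i : Fin 2) (j : Fin m) : (fac gen u v i j).support ⊆ frame gen j := by
  intro e he
  rcases Finset.mem_union.mp (support_add he) with h | h
  · have := support_monomial_subset h
    rw [Finset.mem_singleton] at this
    simp [frame, this]
  · have := support_monomial_subset h
    rw [Finset.mem_singleton] at this
    simp [frame, this]

/-- Integer subset-sum coordinates of a subset of generators. -/
def ss (S : Finset (Fin m)) : ℤ × ℤ := (∑ j ∈ S, ((gen j).1 : ℤ), ∑ j ∈ S, ((gen j).2 : ℤ))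

/-- Integer pairing. -/
def dot (w p : ℤ × ℤ) : ℤ := w.1 * p.1 + w.2 * p.2

/-- The rank-2 tensor value at the word of `S`: `Σ_i Π_j (v_ij if j ∈ S else u_ij)`. -/
def tval (S : Finset (Fin m)) : ℤ := ∑ i, ∏ j, (if j ∈ S then v i j else u i j)

/-- The frame word of a subset: letter `d_j` on `S`, letter `0` off `S`. -/
noncomputable def word (S : Finset (Fin m)) : Fin m → (Fin 2 →₀ ℕ) :=
  fun j => if j ∈ S then dvec gen j else 0

theorem word_mem (S : Finset (Fin m)) (j : Fin m) : word gen S j ∈ frame gen j := by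
  by_cases h : j ∈ S <;> simp [word, frame, h]

theorem sum_word (S : Finset (Fin m)) : ∑ j, word gen S j = ∑ j ∈ S, dvec gen j := by
  simp only [word]
  rw [Finset.sum_ite_mem, Finset.univ_inter]

theorem exists_subset_of_word (a : Fin m → (Fin 2 →₀ ℕ)) (ha : ∀ j, a j ∈ frame gen j) :
    ∃ S : Finset (Fin m), a = word gen S := by
  classical
  refine ⟨Finset.univ.filter (fun j => a j = dvec gen j), ?_⟩
  funext j
  have hj := ha j
  simp only [frame, Finset.mem_insert, Finset.mem_singleton] at hj
  by_cases h : a j = dvec gen j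
  · have hmem : j ∈ Finset.univ.filter (fun j => a j = dvec gen j) :=
      Finset.mem_filter.mpr ⟨Finset.mem_univ _, h⟩
    rw [word, if_pos hmem, h]
  · have hnot : j ∉ Finset.univ.filter (fun j => a j = dvec gen j) := fun hm =>
      h (Finset.mem_filter.mp hm).2
    rw [word, if_neg hnot]
    rcases hj with h0 | h1
    · exact h0
    · exact absurd h1 h

theorem dsum_apply_zero (S : Finset (Fin m)) :
    ((∑ j ∈ S, dvec gen j) 0 : ℕ) = ∑ j ∈ S, (gen j).1 := by
  rw [Finsupp.finsetSum_apply]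
  simp

theorem dsum_apply_one (S : Finset (Fin m)) :
    ((∑ j ∈ S, dvec gen j) 1 : ℕ) = ∑ j ∈ S, (gen j).2 := by
  rw [Finsupp.finsetSum_apply]
  simp

/-- Distinct subset sums (checked by a cardinality computation) make `ss` injective. -/
theorem ss_injective_of_card (hcard : ((Finset.univ : Finset (Fin m)).powerset.image (ss gen)).card = 2 ^ m) :
    Function.Injective (ss gen) := by
  have h : ((Finset.univ : Finset (Fin m)).powerset.image (ss gen)).card =
      (Finset.univ : Finset (Fin m)).powerset.card := by
    rw [hcard, Finset.card_powerset, Finset.card_univ, Fintype.card_fin]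
  have hinj := Finset.card_image_iff.mp h
  intro S S' hSS'
  exact hinj (by simp) (by simp) hSS'

theorem dsum_injective (hss : Function.Injective (ss gen))
    (S S' : Finset (Fin m)) (h : ∑ j ∈ S, dvec gen j = ∑ j ∈ S', dvec gen j) : S = S' := by
  apply hss
  have h0 := congrArg (fun e => ((e 0 : ℕ) : ℤ)) h
  have h1 := congrArg (fun e => ((e 1 : ℕ) : ℤ)) h
  simp only [dsum_apply_zero, dsum_apply_one] at h0 h1
  push_cast at h0 h1
  exact Prod.ext h0 h1

/-- The binomial frame is dissociated once the subset sums are distinct. -/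
theorem frame_dissociated (hss : Function.Injective (ss gen)) :
    ∀ a b : Fin m → (Fin 2 →₀ ℕ), (∀ j, a j ∈ frame gen j) → (∀ j, b j ∈ frame gen j) →
      ∑ j, a j = ∑ j, b j → a = b := by
  intro a b ha hb hab
  obtain ⟨S, rfl⟩ := exists_subset_of_word gen a ha
  obtain ⟨S', rfl⟩ := exists_subset_of_word gen b hb
  rw [sum_word, sum_word] at hab
  rw [dsum_injective gen hss S S' hab]

theorem dvec_ne_zero (hgen : ∀ j, gen j ≠ (0, 0)) (j : Fin m) : dvec gen j ≠ 0 := by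
  intro h
  apply hgen j
  have h0 := congrArg (fun e => e 0) h
  have h1 := congrArg (fun e => e 1) h
  simp only [dvec_apply_zero, dvec_apply_one, Finsupp.coe_zero, Pi.zero_apply] at h0 h1
  exact Prod.ext h0 h1

/-- Coefficients of the factors at the frame letters. -/
theorem coeff_fac_word (hgen : ∀ j, gen j ≠ (0, 0)) (i : Fin 2) (S : Finset (Fin m)) (j : Fin m) :
    coeff (word gen S j) (fac gen u v i j) = (((if j ∈ S then v i j else u i j) : ℤ) : ℂ) := by
  have hne := dvec_ne_zero gen hgen j
  by_cases h : j ∈ S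
  · rw [word, if_pos h, fac, coeff_add, coeff_monomial, coeff_monomial, if_neg hne.symm, if_pos rfl,
      if_pos h, zero_add]
  · rw [word, if_neg h, fac, coeff_add, coeff_monomial, coeff_monomial, if_pos rfl, if_neg hne,
      if_neg h, add_zero]

/-- The complex tensor value at the word of `S` is the integer `tval S`. -/
theorem tensor_word (hgen : ∀ j, gen j ≠ (0, 0)) (S : Finset (Fin m)) :
    (∑ i, ∏ j, coeff (word gen S j) (fac gen u v i j)) = ((tval u v S : ℤ) : ℂ) := by
  simp only [coeff_fac_word gen u v hgen, tval]
  push_cast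
  rfl

/-- The linear functional `(X, Y) ↦ w₁ X + w₂ Y` on `ℝ²`. -/
noncomputable def lfun (w : ℤ × ℤ) : (Fin 2 → ℝ) →ₗ[ℝ] ℝ :=
  (w.1 : ℝ) • LinearMap.proj 0 + (w.2 : ℝ) • LinearMap.proj 1

theorem lfun_emb_dsum (w : ℤ × ℤ) (S : Finset (Fin m)) :
    lfun w (emb (∑ j ∈ S, dvec gen j)) = ((dot w (ss gen S) : ℤ) : ℝ) := by
  simp only [lfun, LinearMap.add_apply, LinearMap.smul_apply, LinearMap.proj_apply, emb,
    dsum_apply_zero, dsum_apply_one, dot, ss, smul_eq_mul]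
  push_cast
  ring

/-- **Vertex certificate.**  If `tval S₀ ≠ 0` and an integer functional `w` puts every OTHER surviving
subset strictly below `S₀`, then the point of `S₀` is a vertex of the Newton polygon. -/
theorem vertex_of_cert (hgen : ∀ j, gen j ≠ (0, 0)) (hss : Function.Injective (ss gen))
    (S₀ : Finset (Fin m)) (w : ℤ × ℤ) (hT : tval u v S₀ ≠ 0)
    (hsep : ∀ S, S ≠ S₀ → tval u v S ≠ 0 → dot w (ss gen S) < dot w (ss gen S₀)) :
    emb (∑ j ∈ S₀, dvec gen j) ∈ Set.extremePoints ℝ (convexHull ℝ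
      (emb '' ((∑ i, ∏ j, fac gen u v i j).support : Set (Fin 2 →₀ ℕ)))) := by
  have hsupp := support_fac_subset gen u v
  have hinj := frame_dissociated gen hss
  refine mem_extremePoints_convexHull_of_strict_sep ?_ (lfun w) ?_
  · refine ⟨∑ j ∈ S₀, dvec gen j, ?_, rfl⟩
    rw [Finset.mem_coe, mem_support_iff, ← sum_word,
      coeff_sum_prod_of_dissociated (frame gen) (fac gen u v) hsupp hinj (word gen S₀) (word_mem gen S₀),
      tensor_word gen u v hgen]
    exact_mod_cast hT
  · rintro y ⟨e, he, rfl⟩ hne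
    obtain ⟨a, ha, hae, hTa⟩ := exists_word_of_mem_support (frame gen) (fac gen u v) hsupp hinj he
    obtain ⟨S, rfl⟩ := exists_subset_of_word gen a ha
    rw [sum_word] at hae
    subst hae
    rw [tensor_word gen u v hgen] at hTa
    have hTS : tval u v S ≠ 0 := by exact_mod_cast hTa
    have hS : S ≠ S₀ := by
      rintro rfl
      exact hne rfl
    have := hsep S hS hTS
    rw [lfun_emb_dsum, lfun_emb_dsum]
    exact_mod_cast this

/-- **Counting certified vertices.**  Distinct certified subsets give distinct vertices, so a finset
`Cs` of certified subsets bounds the vertex count from below. -/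
theorem card_le_vertices (hgen : ∀ j, gen j ≠ (0, 0)) (hss : Function.Injective (ss gen))
    (Cs : Finset (Finset (Fin m)))
    (hCs : ∀ S₀ ∈ Cs, tval u v S₀ ≠ 0 ∧
      ∃ w : ℤ × ℤ, ∀ S, S ≠ S₀ → tval u v S ≠ 0 → dot w (ss gen S) < dot w (ss gen S₀)) :
    Cs.card ≤ (Set.extremePoints ℝ (convexHull ℝ
      (emb '' ((∑ i, ∏ j, fac gen u v i j).support : Set (Fin 2 →₀ ℕ))))).ncard := by
  classical
  set EP := Set.extremePoints ℝ (convexHull ℝ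
      (emb '' ((∑ i, ∏ j, fac gen u v i j).support : Set (Fin 2 →₀ ℕ)))) with hEP
  let pt : Finset (Fin m) → (Fin 2 → ℝ) := fun S => emb (∑ j ∈ S, dvec gen j)
  have hpt_inj : Function.Injective pt := by
    intro S S' h
    exact dsum_injective gen hss S S' (emb_injective h)
  have hfin : EP.Finite := by
    refine Set.Finite.subset (Set.Finite.image emb
      ((∑ i, ∏ j, fac gen u v i j).support).finite_toSet) ?_
    exact extremePoints_convexHull_subset
  have hsub : ((Cs.image pt : Finset (Fin 2 → ℝ)) : Set (Fin 2 → ℝ)) ⊆ EP := by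
    intro p hp
    rw [Finset.mem_coe, Finset.mem_image] at hp
    obtain ⟨S, hS, rfl⟩ := hp
    obtain ⟨hT, w, hsep⟩ := hCs S hS
    exact vertex_of_cert gen u v hgen hss S w hT hsep
  calc Cs.card = (Cs.image pt).card := (Finset.card_image_of_injective _ hpt_inj).symm
    _ = ((Cs.image pt : Finset (Fin 2 → ℝ)) : Set (Fin 2 → ℝ)).ncard := (Set.ncard_coe_finset _).symm
    _ ≤ EP.ncard := Set.ncard_le_ncard hsub hfin

/-- List form for `decide`d instances: certificates `(S₀, w)` with pairwise distinct `S₀`. -/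
theorem length_le_vertices (hgen : ∀ j, gen j ≠ (0, 0)) (hss : Function.Injective (ss gen))
    (certs : List (Finset (Fin m) × (ℤ × ℤ)))
    (hcerts : ∀ c ∈ certs, tval u v c.1 ≠ 0 ∧
      ∀ S ∈ (Finset.univ : Finset (Fin m)).powerset, S ≠ c.1 → tval u v S ≠ 0 →
        dot c.2 (ss gen S) < dot c.2 (ss gen c.1))
    (hnodup : (certs.map Prod.fst).Nodup) :
    certs.length ≤ (Set.extremePoints ℝ (convexHull ℝ
      (emb '' ((∑ i, ∏ j, fac gen u v i j).support : Set (Fin 2 →₀ ℕ))))).ncard := by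
  classical
  have h := card_le_vertices gen u v hgen hss (certs.map Prod.fst).toFinset (by
    intro S₀ hS₀
    rw [List.mem_toFinset, List.mem_map] at hS₀
    obtain ⟨c, hc, rfl⟩ := hS₀
    obtain ⟨hT, hsep⟩ := hcerts c hc
    exact ⟨hT, c.2, fun S hS hTS => hsep S (by simp) hS hTS⟩)
  calc certs.length = (certs.map Prod.fst).length := by simp
    _ = (certs.map Prod.fst).toFinset.card := (List.toFinset_card_of_nodup hnodup).symm
    _ ≤ _ := h

end Pencil

/-! ## Three abstract separation lemmas for additive set functions -/

section SetFun

variable {ι : Type*} [Fintype ι] [DecidableEq ι] (g : ι → ℤ)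

/-- If `g` never vanishes, its positivity set is the unique strict maximiser of `S ↦ Σ_S g`. -/
theorem sum_lt_sum_filter_pos (hg : ∀ i, g i ≠ 0) (S : Finset ι)
    (hS : S ≠ Finset.univ.filter (fun i => 0 < g i)) :
    ∑ i ∈ S, g i < ∑ i ∈ Finset.univ.filter (fun i => 0 < g i), g i := by
  set P := Finset.univ.filter (fun i => 0 < g i) with hP
  have hmemP : ∀ i, i ∈ P ↔ 0 < g i := fun i => by simp [hP]
  have h1 : ∑ i ∈ S ∩ P, g i + ∑ i ∈ S \ P, g i = ∑ i ∈ S, g i := Finset.sum_inter_add_sum_sdiff S P g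
  have h2 : ∑ i ∈ P ∩ S, g i + ∑ i ∈ P \ S, g i = ∑ i ∈ P, g i := Finset.sum_inter_add_sum_sdiff P S g
  have hneg : ∑ i ∈ S \ P, g i ≤ 0 := by
    refine Finset.sum_nonpos (fun i hi => ?_)
    have : i ∉ P := (Finset.mem_sdiff.mp hi).2
    rw [hmemP] at this
    omega
  have hpos : 0 ≤ ∑ i ∈ P \ S, g i := by
    refine Finset.sum_nonneg (fun i hi => ?_)
    have : i ∈ P := (Finset.mem_sdiff.mp hi).1
    rw [hmemP] at this
    omega
  have hcomm : S ∩ P = P ∩ S := Finset.inter_comm S P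
  -- one of the two differences is nonempty
  have hne : (S \ P).Nonempty ∨ (P \ S).Nonempty := by
    by_contra h
    simp only [not_or, Finset.not_nonempty_iff_eq_empty, Finset.sdiff_eq_empty_iff_subset] at h
    exact hS (Finset.Subset.antisymm h.1 h.2)
  rcases hne with h | h
  · have hneg' : ∑ i ∈ S \ P, g i < 0 := by
      refine Finset.sum_neg (fun i hi => ?_) h
      have hi' : i ∉ P := (Finset.mem_sdiff.mp hi).2
      rw [hmemP] at hi'
      have := hg i
      omega
    rw [hcomm] at h1
    omega
  · have hpos' : 0 < ∑ i ∈ P \ S, g i := by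
      refine Finset.sum_pos (fun i hi => ?_) h
      have hi' : i ∈ P := (Finset.mem_sdiff.mp hi).1
      exact (hmemP i).mp hi'
    rw [hcomm] at h1
    omega

omit [Fintype ι] in
/-- If `g < 0` everywhere with a strict unique maximum at `j`, then `{j}` is the unique strict
maximiser of `S ↦ Σ_S g` among NONEMPTY subsets. -/
theorem sum_lt_of_neg (j : ι) (hneg : ∀ i, g i < 0) (hmax : ∀ i, i ≠ j → g i < g j)
    (S : Finset ι) (hS : S.Nonempty) (hSj : S ≠ {j}) : ∑ i ∈ S, g i < g j := by
  obtain ⟨i, hi⟩ := hS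
  have hgi : g i ≤ g j := by
    rcases eq_or_ne i j with rfl | h
    · exact le_rfl
    · exact (hmax i h).le
  by_cases h : S = {i}
  · subst h
    have hij : i ≠ j := fun h => hSj (by rw [h])
    simpa using hmax i hij
  · -- `S` has a second element, so the rest of the sum is negative
    have hne : (S.erase i).Nonempty := by
      by_contra hc
      rw [Finset.not_nonempty_iff_eq_empty, Finset.erase_eq_empty_iff] at hc
      rcases hc with hc | hc
      · rw [hc] at hi; simp at hi
      · exact h hc
    have hrest : ∑ i' ∈ S.erase i, g i' < 0 := Finset.sum_neg (fun i' _ => hneg i') hne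
    have := Finset.add_sum_erase S g hi
    omega

/-- If `g > 0` everywhere with a strict unique minimum at `j`, then `univ.erase j` is the unique strict
maximiser of `S ↦ Σ_S g` among PROPER subsets. -/
theorem sum_lt_sum_erase_of_pos (j : ι) (hpos : ∀ i, 0 < g i) (hmin : ∀ i, i ≠ j → g j < g i)
    (S : Finset ι) (hS : S ≠ Finset.univ) (hSj : S ≠ Finset.univ.erase j) :
    ∑ i ∈ S, g i < ∑ i ∈ Finset.univ.erase j, g i := by
  have hc : Sᶜ.Nonempty := by
    rw [Finset.nonempty_iff_ne_empty, Ne, Finset.compl_eq_empty_iff]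
    exact hS
  have hcj : Sᶜ ≠ {j} := by
    intro h
    apply hSj
    have := congrArg (fun T : Finset ι => Tᶜ) h
    simp only [compl_compl] at this
    rw [this, ← Finset.compl_singleton]
  have key := sum_lt_of_neg (fun i => - g i) j (fun i => by simpa using hpos i)
    (fun i hi => by simpa using hmin i hi) Sᶜ hc hcj
  have h1 := Finset.sum_add_sum_compl S g
  have h2 := Finset.sum_erase_add Finset.univ g (Finset.mem_univ j)
  simp only [Finset.sum_neg_distrib] at key
  omega

end SetFun

/-! ## The hyperbola family: `m = n+1` generators `d_j = (2^j, 2^{n-j})`, dead set `{∅, univ}` -/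

section Family

variable (n : ℕ)

/-- Generators on the hyperbola `x y = 2^n`: `d_j = (2^j, 2^{n-j})`, `j = 0..n`. -/
def hgen (j : Fin (n + 1)) : ℕ × ℕ := (2 ^ (j : ℕ), 2 ^ (n - (j : ℕ)))

/-- Constant terms: product 0 has all `1`; product 1 carries the sign `-1` on the last factor. -/
def hu (i : Fin 2) (j : Fin (n + 1)) : ℤ :=
  if i = 0 then 1 else if j = Fin.last n then -1 else 1

/-- Top coefficients: product 0 is `Π_{j<n} (1 + 2 X^{d_j}) · (1 + X^{d_n})`, product 1 is
`- Π_{j<n} (1 + X^{d_j}) · (1 + 2^n X^{d_n})`, so `T(S) = 2^{#(S \ {n})} - (2^n)^{[n ∈ S]}` vanishes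
exactly at `S = ∅` and `S = univ`. -/
def hv (i : Fin 2) (j : Fin (n + 1)) : ℤ :=
  if i = 0 then (if j = Fin.last n then 1 else 2) else (if j = Fin.last n then -(2 ^ n) else 1)

theorem hgen_ne (j : Fin (n + 1)) : hgen n j ≠ (0, 0) := by
  simp [hgen]

/-- Binary digits: the `x`-coordinates `2^j` alone make the frame dissociated. -/
theorem hss_injective : Function.Injective (ss (hgen n)) := by
  intro S S' h
  have hx : (ss (hgen n) S).1 = (ss (hgen n) S').1 := by rw [h]
  simp only [ss, hgen] at hx
  have hx' : ∑ j ∈ S, (2 : ℕ) ^ (j : ℕ) = ∑ j ∈ S', (2 : ℕ) ^ (j : ℕ) := by exact_mod_cast hx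
  have hmap : ∑ i ∈ S.map Fin.valEmbedding, (2 : ℕ) ^ i = ∑ i ∈ S'.map Fin.valEmbedding, (2 : ℕ) ^ i := by
    rw [Finset.sum_map, Finset.sum_map]
    exact hx'
  exact Finset.map_injective Fin.valEmbedding (Finset.geomSum_injective (n := 2) le_rfl hmap)

/-- The tensor value of the family. -/
theorem tval_family (S : Finset (Fin (n + 1))) :
    tval (hu n) (hv n) S = 2 ^ (S.erase (Fin.last n)).card - (if Fin.last n ∈ S then 2 ^ n else 1) := by
  simp only [tval, Fin.sum_univ_two]
  have h0 : (∏ j : Fin (n + 1), (if j ∈ S then hv n 0 j else hu n 0 j)) =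
      (2 : ℤ) ^ (S.erase (Fin.last n)).card := by
    have : (fun j : Fin (n + 1) => (if j ∈ S then hv n 0 j else hu n 0 j)) =
        fun j => if j ∈ S.erase (Fin.last n) then (2 : ℤ) else 1 := by
      funext j
      by_cases hj : j ∈ S <;> by_cases hl : j = Fin.last n <;> simp [hu, hv, hj, hl]
    rw [this, Finset.prod_ite_mem, Finset.univ_inter, Finset.prod_const]
  have h1 : (∏ j : Fin (n + 1), (if j ∈ S then hv n 1 j else hu n 1 j)) =
      -(if Fin.last n ∈ S then (2 : ℤ) ^ n else 1) := by
    have : (fun j : Fin (n + 1) => (if j ∈ S then hv n 1 j else hu n 1 j)) =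
        fun j => if j = Fin.last n then -(if Fin.last n ∈ S then (2 : ℤ) ^ n else 1) else 1 := by
      funext j
      by_cases hl : j = Fin.last n
      · subst hl
        by_cases hj : Fin.last n ∈ S <;> simp [hu, hv, hj]
      · by_cases hj : j ∈ S <;> simp [hu, hv, hj, hl]
    rw [this, Finset.prod_ite_eq']
    simp
  rw [h0, h1]
  ring

theorem tval_family_empty : tval (hu n) (hv n) ∅ = 0 := by
  rw [tval_family]; simp

theorem tval_family_univ : tval (hu n) (hv n) Finset.univ = 0 := by
  rw [tval_family]
  simp [Finset.card_erase_of_mem, Finset.card_univ, Fintype.card_fin]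

/-- `T(S) ≠ 0` exactly off `{∅, univ}` (the direction we need). -/
theorem tval_family_ne_zero (S : Finset (Fin (n + 1))) (h0 : S ≠ ∅) (h1 : S ≠ Finset.univ) :
    tval (hu n) (hv n) S ≠ 0 := by
  rw [tval_family]
  by_cases hl : Fin.last n ∈ S
  · rw [if_pos hl]
    have hcard : (S.erase (Fin.last n)).card < n := by
      rw [Finset.card_erase_of_mem hl]
      have hlt : S.card < n + 1 := by
        have := Finset.card_lt_card (Finset.ssubset_univ_iff.mpr h1)
        simpa [Finset.card_univ, Fintype.card_fin] using this
      have hpos : 0 < S.card := Finset.card_pos.mpr ⟨_, hl⟩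
      omega
    have : (2 : ℤ) ^ (S.erase (Fin.last n)).card < 2 ^ n :=
      pow_lt_pow_right₀ (by norm_num) hcard
    omega
  · rw [if_neg hl, Finset.erase_eq_of_notMem hl]
    have hpos : 0 < S.card := Finset.card_pos.mpr (Finset.nonempty_iff_ne_empty.mpr h0)
    have : (2 : ℤ) ≤ 2 ^ S.card := by
      calc (2 : ℤ) = 2 ^ 1 := by norm_num
        _ ≤ 2 ^ S.card := pow_le_pow_right₀ (by norm_num) hpos
    omega

theorem ne_empty_of_tval_ne_zero (S : Finset (Fin (n + 1))) (h : tval (hu n) (hv n) S ≠ 0) : S ≠ ∅ := by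
  rintro rfl; exact h (tval_family_empty n)

theorem ne_univ_of_tval_ne_zero (S : Finset (Fin (n + 1))) (h : tval (hu n) (hv n) S ≠ 0) :
    S ≠ Finset.univ := by
  rintro rfl; exact h (tval_family_univ n)

/-- Additivity of the pairing over subsets. -/
theorem dot_ss (w : ℤ × ℤ) (S : Finset (Fin (n + 1))) :
    dot w (ss (hgen n) S) = ∑ i ∈ S, (w.1 * ((hgen n i).1 : ℤ) + w.2 * ((hgen n i).2 : ℤ)) := by
  simp only [dot, ss, Finset.mul_sum, Finset.sum_add_distrib]

/-! ### Power-of-two inequalities behind the separating functionals -/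

/-- Singleton functional `w_j = (-2^{n-j}, -2^j)`: value at generator `i`. -/
theorem single_val (j i : Fin (n + 1)) :
    (-(2 : ℤ) ^ (n - (j : ℕ))) * ((hgen n i).1 : ℤ) + (-(2 : ℤ) ^ (j : ℕ)) * ((hgen n i).2 : ℤ) =
      -(((2 ^ (n - (j : ℕ)) * 2 ^ (i : ℕ) + 2 ^ (j : ℕ) * 2 ^ (n - (i : ℕ)) : ℕ) : ℤ)) := by
  simp only [hgen]
  push_cast
  ring

theorem single_nat_self (j : Fin (n + 1)) :
    (2 : ℕ) ^ (n - (j : ℕ)) * 2 ^ (j : ℕ) + 2 ^ (j : ℕ) * 2 ^ (n - (j : ℕ)) = 2 ^ (n + 1) := by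
  have hj : (j : ℕ) ≤ n := Nat.lt_succ_iff.mp j.2
  rw [← pow_add, ← pow_add, Nat.sub_add_cancel hj, Nat.add_sub_cancel' hj, pow_succ]
  ring

theorem single_nat_lt (j i : Fin (n + 1)) (hij : i ≠ j) :
    (2 : ℕ) ^ (n + 1) < 2 ^ (n - (j : ℕ)) * 2 ^ (i : ℕ) + 2 ^ (j : ℕ) * 2 ^ (n - (i : ℕ)) := by
  have hj : (j : ℕ) ≤ n := Nat.lt_succ_iff.mp j.2
  have hi : (i : ℕ) ≤ n := Nat.lt_succ_iff.mp i.2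
  have hne : (i : ℕ) ≠ (j : ℕ) := fun h => hij (Fin.ext h)
  rcases Nat.lt_or_gt_of_ne hne with h | h
  · -- i < j : the second term is ≥ 2^{n+1}
    have e : (2 : ℕ) ^ (j : ℕ) * 2 ^ (n - (i : ℕ)) = 2 ^ (n + 1) * 2 ^ ((j : ℕ) - (i : ℕ) - 1) := by
      rw [← pow_add, ← pow_add]; congr 1; omega
    have h2 : (2 : ℕ) ^ (n + 1) ≤ 2 ^ (j : ℕ) * 2 ^ (n - (i : ℕ)) := by
      rw [e]; exact Nat.le_mul_of_pos_right _ (by positivity)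
    have h3 : 0 < (2 : ℕ) ^ (n - (j : ℕ)) * 2 ^ (i : ℕ) := by positivity
    omega
  · -- j < i : the first term is ≥ 2^{n+1}
    have e : (2 : ℕ) ^ (n - (j : ℕ)) * 2 ^ (i : ℕ) = 2 ^ (n + 1) * 2 ^ ((i : ℕ) - (j : ℕ) - 1) := by
      rw [← pow_add, ← pow_add]; congr 1; omega
    have h2 : (2 : ℕ) ^ (n + 1) ≤ 2 ^ (n - (j : ℕ)) * 2 ^ (i : ℕ) := by
      rw [e]; exact Nat.le_mul_of_pos_right _ (by positivity)
    have h3 : 0 < (2 : ℕ) ^ (j : ℕ) * 2 ^ (n - (i : ℕ)) := by positivity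
    omega

/-- Prefix functional `w_r = (-2^{n+1}, 2^{2r})`: value at generator `i`. -/
theorem prefix_val (r : ℕ) (i : Fin (n + 1)) :
    (-(2 : ℤ) ^ (n + 1)) * ((hgen n i).1 : ℤ) + ((2 : ℤ) ^ (2 * r)) * ((hgen n i).2 : ℤ) =
      (((2 ^ (2 * r) * 2 ^ (n - (i : ℕ)) : ℕ) : ℤ)) - (((2 ^ (n + 1) * 2 ^ (i : ℕ) : ℕ) : ℤ)) := by
  simp only [hgen]
  push_cast
  ring

theorem prefix_nat_lt_of_lt (r : ℕ) (i : Fin (n + 1)) (h : (i : ℕ) < r) :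
    (2 : ℕ) ^ (n + 1) * 2 ^ (i : ℕ) < 2 ^ (2 * r) * 2 ^ (n - (i : ℕ)) := by
  have hi : (i : ℕ) ≤ n := Nat.lt_succ_iff.mp i.2
  rw [← pow_add, ← pow_add]
  exact Nat.pow_lt_pow_right (by norm_num) (by omega)

theorem prefix_nat_lt_of_le (r : ℕ) (i : Fin (n + 1)) (h : r ≤ (i : ℕ)) :
    (2 : ℕ) ^ (2 * r) * 2 ^ (n - (i : ℕ)) < 2 ^ (n + 1) * 2 ^ (i : ℕ) := by
  have hi : (i : ℕ) ≤ n := Nat.lt_succ_iff.mp i.2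
  rw [← pow_add, ← pow_add]
  exact Nat.pow_lt_pow_right (by norm_num) (by omega)

/-! ### The four certified classes of vertices -/

/-- Singletons `{j}` are vertices (exposed from the third quadrant; needs `∅` dead). -/
theorem cert_single (hn : 1 ≤ n) (j : Fin (n + 1)) :
    tval (hu n) (hv n) {j} ≠ 0 ∧ ∃ w : ℤ × ℤ, ∀ S, S ≠ {j} → tval (hu n) (hv n) S ≠ 0 →
      dot w (ss (hgen n) S) < dot w (ss (hgen n) {j}) := by
  refine ⟨tval_family_ne_zero n {j} (Finset.singleton_ne_empty j) ?_, ?_⟩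
  · intro h
    have := congrArg Finset.card h
    simp [Finset.card_univ, Fintype.card_fin] at this
    omega
  · refine ⟨(-(2 : ℤ) ^ (n - (j : ℕ)), -(2 : ℤ) ^ (j : ℕ)), fun S hS hT => ?_⟩
    set g : Fin (n + 1) → ℤ := fun i =>
      (-(2 : ℤ) ^ (n - (j : ℕ))) * ((hgen n i).1 : ℤ) + (-(2 : ℤ) ^ (j : ℕ)) * ((hgen n i).2 : ℤ) with hg
    have hgi : ∀ i, g i = -(((2 ^ (n - (j : ℕ)) * 2 ^ (i : ℕ) + 2 ^ (j : ℕ) * 2 ^ (n - (i : ℕ)) : ℕ) : ℤ)) :=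
      fun i => single_val n j i
    have hneg : ∀ i, g i < 0 := fun i => by rw [hgi, neg_lt_zero]; positivity
    have hmax : ∀ i, i ≠ j → g i < g j := by
      intro i hij
      rw [hgi, hgi, single_nat_self]
      have := single_nat_lt n j i hij
      omega
    have key := sum_lt_of_neg g j hneg hmax S
      (Finset.nonempty_iff_ne_empty.mpr (ne_empty_of_tval_ne_zero n S hT)) hS
    rw [dot_ss, dot_ss, Finset.sum_singleton]
    exact key

/-- Co-singletons `univ \ {j}` are vertices (exposed from the first quadrant; needs `univ` dead). -/
theorem cert_cosingle (hn : 1 ≤ n) (j : Fin (n + 1)) :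
    tval (hu n) (hv n) (Finset.univ.erase j) ≠ 0 ∧ ∃ w : ℤ × ℤ, ∀ S, S ≠ Finset.univ.erase j →
      tval (hu n) (hv n) S ≠ 0 → dot w (ss (hgen n) S) < dot w (ss (hgen n) (Finset.univ.erase j)) := by
  refine ⟨tval_family_ne_zero n _ ?_ ?_, ?_⟩
  · rw [Ne, Finset.erase_eq_empty_iff, not_or]
    refine ⟨Finset.univ_nonempty.ne_empty, fun h => ?_⟩
    have := congrArg Finset.card h
    simp [Finset.card_univ, Fintype.card_fin] at this
    omega
  · intro h
    have hj : j ∈ Finset.univ.erase j := by rw [h]; exact Finset.mem_univ j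
    simp at hj
  · refine ⟨((2 : ℤ) ^ (n - (j : ℕ)), (2 : ℤ) ^ (j : ℕ)), fun S hS hT => ?_⟩
    set g : Fin (n + 1) → ℤ := fun i =>
      ((2 : ℤ) ^ (n - (j : ℕ))) * ((hgen n i).1 : ℤ) + ((2 : ℤ) ^ (j : ℕ)) * ((hgen n i).2 : ℤ) with hg
    have hgi : ∀ i, g i = (((2 ^ (n - (j : ℕ)) * 2 ^ (i : ℕ) + 2 ^ (j : ℕ) * 2 ^ (n - (i : ℕ)) : ℕ) : ℤ)) := by
      intro i
      have := single_val n j i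
      simp only [neg_mul] at this
      rw [hg]
      linarith
    have hpos : ∀ i, 0 < g i := fun i => by rw [hgi]; positivity
    have hmin : ∀ i, i ≠ j → g j < g i := by
      intro i hij
      rw [hgi, hgi, single_nat_self]
      exact_mod_cast single_nat_lt n j i hij
    have key := sum_lt_sum_erase_of_pos g j hpos hmin S (ne_univ_of_tval_ne_zero n S hT) hS
    rw [dot_ss, dot_ss]
    exact key

/-- The prefix `{i : i < r}` as a finset. -/
def pre (r : ℕ) : Finset (Fin (n + 1)) := Finset.univ.filter (fun i => (i : ℕ) < r)

/-- The suffix `{i : r ≤ i}` as a finset. -/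
def suf (r : ℕ) : Finset (Fin (n + 1)) := Finset.univ.filter (fun i => r ≤ (i : ℕ))

theorem card_pre (r : ℕ) (hr : r ≤ n + 1) : (pre n r).card = r := by
  rw [pre, Fin.card_filter_val_lt]
  omega

theorem card_suf (r : ℕ) (hr : r ≤ n + 1) : (suf n r).card = n + 1 - r := by
  have h : suf n r = (pre n r)ᶜ := by
    ext i; simp [suf, pre, not_lt]
  rw [h, Finset.card_compl, card_pre n r hr, Fintype.card_fin]

/-- Prefixes `{i < r}`, `1 ≤ r ≤ n`, are vertices (they are vertices of the full zonogon already). -/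
theorem cert_pre (r : ℕ) (hr1 : 1 ≤ r) (hrn : r ≤ n) :
    tval (hu n) (hv n) (pre n r) ≠ 0 ∧ ∃ w : ℤ × ℤ, ∀ S, S ≠ pre n r → tval (hu n) (hv n) S ≠ 0 →
      dot w (ss (hgen n) S) < dot w (ss (hgen n) (pre n r)) := by
  refine ⟨tval_family_ne_zero n _ ?_ ?_, ?_⟩
  · intro h
    have : (⟨0, by omega⟩ : Fin (n + 1)) ∈ pre n r := by simp [pre]; omega
    rw [h] at this; simp at this
  · intro h
    have : (Fin.last n) ∈ pre n r := by rw [h]; simp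
    simp [pre] at this
    omega
  · refine ⟨(-(2 : ℤ) ^ (n + 1), (2 : ℤ) ^ (2 * r)), fun S hS _ => ?_⟩
    set g : Fin (n + 1) → ℤ := fun i =>
      (-(2 : ℤ) ^ (n + 1)) * ((hgen n i).1 : ℤ) + ((2 : ℤ) ^ (2 * r)) * ((hgen n i).2 : ℤ) with hg
    have hgi : ∀ i, g i = (((2 ^ (2 * r) * 2 ^ (n - (i : ℕ)) : ℕ) : ℤ)) -
        (((2 ^ (n + 1) * 2 ^ (i : ℕ) : ℕ) : ℤ)) := fun i => prefix_val n r i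
    have hgpos : ∀ i : Fin (n + 1), (i : ℕ) < r → 0 < g i := by
      intro i hi; rw [hgi]; have := prefix_nat_lt_of_lt n r i hi; omega
    have hgneg : ∀ i : Fin (n + 1), r ≤ (i : ℕ) → g i < 0 := by
      intro i hi; rw [hgi]; have := prefix_nat_lt_of_le n r i hi; omega
    have hg0 : ∀ i, g i ≠ 0 := by
      intro i
      rcases Nat.lt_or_ge (i : ℕ) r with h | h
      · exact (hgpos i h).ne'
      · exact (hgneg i h).ne
    have hP : pre n r = Finset.univ.filter (fun i => 0 < g i) := by
      ext i
      simp only [pre, Finset.mem_filter, Finset.mem_univ, true_and]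
      constructor
      · exact hgpos i
      · intro h
        by_contra hc
        have := hgneg i (not_lt.mp hc)
        omega
    have key := sum_lt_sum_filter_pos g hg0 S (hP ▸ hS)
    rw [dot_ss, dot_ss, hP]
    exact key

/-- Suffixes `{r ≤ i}`, `1 ≤ r ≤ n`, are vertices. -/
theorem cert_suf (r : ℕ) (hr1 : 1 ≤ r) (hrn : r ≤ n) :
    tval (hu n) (hv n) (suf n r) ≠ 0 ∧ ∃ w : ℤ × ℤ, ∀ S, S ≠ suf n r → tval (hu n) (hv n) S ≠ 0 →
      dot w (ss (hgen n) S) < dot w (ss (hgen n) (suf n r)) := by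
  refine ⟨tval_family_ne_zero n _ ?_ ?_, ?_⟩
  · intro h
    have : (Fin.last n) ∈ suf n r := by simp [suf]; omega
    rw [h] at this; simp at this
  · intro h
    have : (⟨0, by omega⟩ : Fin (n + 1)) ∈ suf n r := by rw [h]; simp
    simp [suf] at this
    omega
  · refine ⟨((2 : ℤ) ^ (n + 1), -(2 : ℤ) ^ (2 * r)), fun S hS _ => ?_⟩
    set g : Fin (n + 1) → ℤ := fun i =>
      ((2 : ℤ) ^ (n + 1)) * ((hgen n i).1 : ℤ) + (-(2 : ℤ) ^ (2 * r)) * ((hgen n i).2 : ℤ) with hg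
    have hgi : ∀ i, g i = (((2 ^ (n + 1) * 2 ^ (i : ℕ) : ℕ) : ℤ)) -
        (((2 ^ (2 * r) * 2 ^ (n - (i : ℕ)) : ℕ) : ℤ)) := by
      intro i; have := prefix_val n r i; rw [hg]; simp only [neg_mul]; linarith
    have hgpos : ∀ i : Fin (n + 1), r ≤ (i : ℕ) → 0 < g i := by
      intro i hi; rw [hgi]; have := prefix_nat_lt_of_le n r i hi; omega
    have hgneg : ∀ i : Fin (n + 1), (i : ℕ) < r → g i < 0 := by
      intro i hi; rw [hgi]; have := prefix_nat_lt_of_lt n r i hi; omega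
    have hg0 : ∀ i, g i ≠ 0 := by
      intro i
      rcases Nat.lt_or_ge (i : ℕ) r with h | h
      · exact (hgneg i h).ne
      · exact (hgpos i h).ne'
    have hP : suf n r = Finset.univ.filter (fun i => 0 < g i) := by
      ext i
      simp only [suf, Finset.mem_filter, Finset.mem_univ, true_and]
      constructor
      · exact hgpos i
      · intro h
        by_contra hc
        have := hgneg i (not_le.mp hc)
        omega
    have key := sum_lt_sum_filter_pos g hg0 S (hP ▸ hS)
    rw [dot_ss, dot_ss, hP]
    exact key

/-! ### Assembly: `4n - 2 = 4m - 6` certified vertices -/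

/-- The certified subsets: singletons, co-singletons, prefixes and suffixes of middle length. -/
def certSet : Finset (Finset (Fin (n + 1))) :=
  ((Finset.univ.image (fun j : Fin (n + 1) => ({j} : Finset (Fin (n + 1))))) ∪
    (Finset.univ.image (fun j : Fin (n + 1) => Finset.univ.erase j))) ∪
  (((Finset.Icc 2 (n - 1)).image (pre n)) ∪ ((Finset.Icc 2 (n - 1)).image (suf n)))

theorem card_certSet (hn : 3 ≤ n) : (certSet n).card = 4 * n - 2 := by
  classical
  -- the four classes and their cardinalities
  have c1 : (Finset.univ.image (fun j : Fin (n + 1) => ({j} : Finset (Fin (n + 1))))).card = n + 1 := by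
    rw [Finset.card_image_of_injective _ Finset.singleton_injective, Finset.card_univ, Fintype.card_fin]
  have c2 : (Finset.univ.image (fun j : Fin (n + 1) => Finset.univ.erase j)).card = n + 1 := by
    rw [Finset.card_image_of_injOn (Finset.erase_injOn Finset.univ), Finset.card_univ, Fintype.card_fin]
  have c3 : ((Finset.Icc 2 (n - 1)).image (pre n)).card = n - 2 := by
    rw [Finset.card_image_of_injOn, Nat.card_Icc]
    · omega
    · intro r hr r' hr' h
      have hr2 := (Finset.mem_Icc.mp (Finset.mem_coe.mp hr)).2
      have hr'2 := (Finset.mem_Icc.mp (Finset.mem_coe.mp hr')).2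
      have := congrArg Finset.card h
      rwa [card_pre n r (by omega), card_pre n r' (by omega)] at this
  have c4 : ((Finset.Icc 2 (n - 1)).image (suf n)).card = n - 2 := by
    rw [Finset.card_image_of_injOn, Nat.card_Icc]
    · omega
    · intro r hr r' hr' h
      have hr2 := (Finset.mem_Icc.mp (Finset.mem_coe.mp hr)).2
      have hr'2 := (Finset.mem_Icc.mp (Finset.mem_coe.mp hr')).2
      have := congrArg Finset.card h
      rw [card_suf n r (by omega), card_suf n r' (by omega)] at this
      omega
  -- cardinalities of members of each class
  have m1 : ∀ S ∈ Finset.univ.image (fun j : Fin (n + 1) => ({j} : Finset (Fin (n + 1)))), S.card = 1 := by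
    intro S hS
    obtain ⟨j, _, rfl⟩ := Finset.mem_image.mp hS
    simp
  have m2 : ∀ S ∈ Finset.univ.image (fun j : Fin (n + 1) => Finset.univ.erase j), S.card = n := by
    intro S hS
    obtain ⟨j, _, rfl⟩ := Finset.mem_image.mp hS
    simp [Finset.card_erase_of_mem, Finset.card_univ, Fintype.card_fin]
  have m3 : ∀ S ∈ (Finset.Icc 2 (n - 1)).image (pre n), 2 ≤ S.card ∧ S.card ≤ n - 1 ∧
      (⟨0, by omega⟩ : Fin (n + 1)) ∈ S := by
    intro S hS
    obtain ⟨r, hr, rfl⟩ := Finset.mem_image.mp hS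
    obtain ⟨hr1, hr2⟩ := Finset.mem_Icc.mp hr
    rw [card_pre n r (by omega)]
    refine ⟨hr1, hr2, ?_⟩
    simp [pre]
    omega
  have m4 : ∀ S ∈ (Finset.Icc 2 (n - 1)).image (suf n), 2 ≤ S.card ∧ S.card ≤ n - 1 ∧
      (⟨0, by omega⟩ : Fin (n + 1)) ∉ S := by
    intro S hS
    obtain ⟨r, hr, rfl⟩ := Finset.mem_image.mp hS
    obtain ⟨hr1, hr2⟩ := Finset.mem_Icc.mp hr
    rw [card_suf n r (by omega)]
    refine ⟨by omega, by omega, ?_⟩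
    simp [suf]
    omega
  -- pairwise disjointness
  have d12 : Disjoint (Finset.univ.image (fun j : Fin (n + 1) => ({j} : Finset (Fin (n + 1)))))
      (Finset.univ.image (fun j : Fin (n + 1) => Finset.univ.erase j)) := by
    rw [Finset.disjoint_left]
    intro S h1 h2
    have := m1 S h1; have := m2 S h2; omega
  have d34 : Disjoint ((Finset.Icc 2 (n - 1)).image (pre n)) ((Finset.Icc 2 (n - 1)).image (suf n)) := by
    rw [Finset.disjoint_left]
    intro S h3 h4
    exact (m4 S h4).2.2 (m3 S h3).2.2
  have dAB : Disjoint ((Finset.univ.image (fun j : Fin (n + 1) => ({j} : Finset (Fin (n + 1))))) ∪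
      (Finset.univ.image (fun j : Fin (n + 1) => Finset.univ.erase j)))
      (((Finset.Icc 2 (n - 1)).image (pre n)) ∪ ((Finset.Icc 2 (n - 1)).image (suf n))) := by
    rw [Finset.disjoint_left]
    intro S hA hB
    rcases Finset.mem_union.mp hB with h | h
    · have hc := (m3 S h).1; have hc' := (m3 S h).2.1
      rcases Finset.mem_union.mp hA with h' | h'
      · have := m1 S h'; omega
      · have := m2 S h'; omega
    · have hc := (m4 S h).1; have hc' := (m4 S h).2.1
      rcases Finset.mem_union.mp hA with h' | h'
      · have := m1 S h'; omega
      · have := m2 S h'; omega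
  rw [certSet, Finset.card_union_of_disjoint dAB, Finset.card_union_of_disjoint d12,
    Finset.card_union_of_disjoint d34, c1, c2, c3, c4]
  omega

theorem certSet_cert (hn : 3 ≤ n) : ∀ S₀ ∈ certSet n, tval (hu n) (hv n) S₀ ≠ 0 ∧
    ∃ w : ℤ × ℤ, ∀ S, S ≠ S₀ → tval (hu n) (hv n) S ≠ 0 →
      dot w (ss (hgen n) S) < dot w (ss (hgen n) S₀) := by
  intro S₀ hS₀
  rcases Finset.mem_union.mp hS₀ with h | h
  · rcases Finset.mem_union.mp h with h | h
    · obtain ⟨j, _, rfl⟩ := Finset.mem_image.mp h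
      exact cert_single n (by omega) j
    · obtain ⟨j, _, rfl⟩ := Finset.mem_image.mp h
      exact cert_cosingle n (by omega) j
  · rcases Finset.mem_union.mp h with h | h
    · obtain ⟨r, hr, rfl⟩ := Finset.mem_image.mp h
      obtain ⟨hr1, hr2⟩ := Finset.mem_Icc.mp hr
      exact cert_pre n r (by omega) (by omega)
    · obtain ⟨r, hr, rfl⟩ := Finset.mem_image.mp h
      obtain ⟨hr1, hr2⟩ := Finset.mem_Icc.mp hr
      exact cert_suf n r (by omega) (by omega)

/-- **The hyperbola family has at least `4n - 2 = 4m - 6` Newton-polygon vertices** (`m = n + 1 ≥ 4`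
binomial factors, two products, dissociated frame). -/
theorem family_vertices (hn : 3 ≤ n) :
    4 * n - 2 ≤ (Set.extremePoints ℝ (convexHull ℝ
      (emb '' ((∑ i, ∏ j, fac (hgen n) (hu n) (hv n) i j).support : Set (Fin 2 →₀ ℕ))))).ncard := by
  rw [← card_certSet n hn]
  exact card_le_vertices (hgen n) (hu n) (hv n) (hgen_ne n) (hss_injective n) (certSet n)
    (certSet_cert n hn)

end Family

/-! ## Consequences for the crux `DissociatedFixedK` -/

/-- `DissociatedFixedK` specialised to `k = 2` products with the exponent frozen at `C = 1`
(the no-cancellation / Minkowski count `m t` plus `2`). -/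
def DissociatedFixedKTwoExpOne : Prop :=
  ∀ (m t : ℕ) (A : Fin m → Finset (Fin 2 →₀ ℕ)) (f : Fin 2 → Fin m → MvPolynomial (Fin 2) ℂ),
    (∀ j, (A j).card ≤ t) → (∀ i j, (f i j).support ⊆ A j) →
    (∀ a b : Fin m → (Fin 2 →₀ ℕ), (∀ j, a j ∈ A j) → (∀ j, b j ∈ A j) → ∑ j, a j = ∑ j, b j → a = b) →
    (Set.extremePoints ℝ (convexHull ℝ ((fun e : Fin 2 →₀ ℕ => fun i : Fin 2 => ((e i : ℕ) : ℝ)) ''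
      ((∑ i, ∏ j, f i j).support : Set (Fin 2 →₀ ℕ))))).ncard ≤ (m * t + 2) ^ 1

/-- **Two products already beat the Minkowski count: in the crux's vocabulary.**  For every `m ≥ 4`
there are a dissociated binomial frame `A` (`#A j ≤ 2`) and two products of binomials supported on it
whose sum has at least `4m - 6` Newton-polygon vertices (versus `≤ m t = 2m` for one product). -/
theorem two_products_many_vertices (m : ℕ) (hm : 4 ≤ m) :
    ∃ (A : Fin m → Finset (Fin 2 →₀ ℕ)) (f : Fin 2 → Fin m → MvPolynomial (Fin 2) ℂ),
      (∀ j, (A j).card ≤ 2) ∧ (∀ i j, (f i j).support ⊆ A j) ∧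
      (∀ a b : Fin m → (Fin 2 →₀ ℕ), (∀ j, a j ∈ A j) → (∀ j, b j ∈ A j) →
        ∑ j, a j = ∑ j, b j → a = b) ∧
      4 * m - 6 ≤ (Set.extremePoints ℝ (convexHull ℝ
        ((fun e : Fin 2 →₀ ℕ => fun i : Fin 2 => ((e i : ℕ) : ℝ)) ''
          ((∑ i, ∏ j, f i j).support : Set (Fin 2 →₀ ℕ))))).ncard := by
  obtain ⟨n, rfl⟩ : ∃ n, m = n + 1 := ⟨m - 1, by omega⟩
  refine ⟨frame (hgen n), fac (hgen n) (hu n) (hv n), card_frame_le _, support_fac_subset _ _ _,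
    frame_dissociated _ (hss_injective n), ?_⟩
  rw [show (fun e : Fin 2 →₀ ℕ => fun i : Fin 2 => ((e i : ℕ) : ℝ)) = emb from rfl]
  have h := family_vertices n (by omega)
  have e : 4 * (n + 1) - 6 = 4 * n - 2 := by omega
  rw [e]
  exact h

/-- **The exponent `C = 1` fails for `k = 2`.**  Any `C` with
`#vert ≤ (mt+2)^C` for all two-product dissociated instances satisfies `C ≥ 2`: at `m = 5`, `t = 2`
the hyperbola family has `≥ 14 > 12 = m t + 2` vertices (and `4m - 6 > 2m + 2` for all `m ≥ 5`). -/
theorem not_dissociatedFixedKTwoExpOne : ¬ DissociatedFixedKTwoExpOne := by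
  intro h
  obtain ⟨A, f, hA, hf, hinj, hV⟩ := two_products_many_vertices 5 (by norm_num)
  have hle := h 5 2 A f hA hf hinj
  omega

/-- Sanity: `DissociatedFixedKTwoExpOne` is literally the crux's inner statement at `k = 2`, `C = 1`. -/
theorem dissociatedFixedK_two_of_expOne (h : DissociatedFixedKTwoExpOne) :
    ∃ C : ℕ, ∀ (m t : ℕ) (A : Fin m → Finset (Fin 2 →₀ ℕ)) (f : Fin 2 → Fin m → MvPolynomial (Fin 2) ℂ),
    (∀ j, (A j).card ≤ t) → (∀ i j, (f i j).support ⊆ A j) →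
    (∀ a b : Fin m → (Fin 2 →₀ ℕ), (∀ j, a j ∈ A j) → (∀ j, b j ∈ A j) → ∑ j, a j = ∑ j, b j → a = b) →
    (Set.extremePoints ℝ (convexHull ℝ ((fun e : Fin 2 →₀ ℕ => fun i : Fin 2 => ((e i : ℕ) : ℝ)) ''
      ((∑ i, ∏ j, f i j).support : Set (Fin 2 →₀ ℕ))))).ncard ≤ (m * t + 2) ^ C :=
  ⟨1, h⟩



/-! ## A second, search-found witness, certified by `decide` (exercises the list-certificate route) -/

section DecideInstance

/-- Search-found `m = 5` instance (`kit/k2_clean.py`): generators. -/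
def gen5 : Fin 5 → ℕ × ℕ := ![(11, 4), (8, 12), (9, 6), (8, 9), (12, 4)]
/-- Search-found instance: constant terms (`-c = -1` on factor `0` of product `1`). -/
def u5 : Fin 2 → Fin 5 → ℤ := ![![1, 1, 1, 1, 1], ![-1, 1, 1, 1, 1]]
/-- Search-found instance: top coefficients `a = (-2,1,-1,-2,-2)`, `-c·b₀, b = (1,-2,2,-1,2)`. -/
def v5 : Fin 2 → Fin 5 → ℤ := ![![-2, 1, -1, -2, -2], ![-1, -2, 2, -1, 2]]
/-- The `14` hull vertices with integer separating functionals (dead set `{∅, {0,1}, {0,2}, {1,3,4}, {2,3,4}, univ}`). -/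
def certs5 : List (Finset (Fin 5) × (ℤ × ℤ)) :=
  [({3}, (-6, -1)), ({2}, (-5, -3)), ({0}, (-2, -3)), ({4}, (4, -12)), ({0, 4}, (10, -20)), ({0, 2, 4}, (15, -17)), ({0, 2, 3, 4}, (12, -8)), ({0, 1, 2, 4}, (6, 1)), ({0, 1, 3, 4}, (5, 3)), ({1, 2, 3, 4}, (2, 3)), ({0, 1, 2, 3}, (-4, 12)), ({1, 2, 3}, (-10, 20)), ({1, 3}, (-15, 17)), ({1}, (-12, 8))]

set_option maxRecDepth 8000 in
/-- The search-found `m = 5`, `t = 2` instance also has `≥ 14 > 12` Newton vertices — every hypothesis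
discharged by `decide` (`32` subsets × `14` certificates). -/
theorem inst5_vertices :
    14 ≤ (Set.extremePoints ℝ (convexHull ℝ
      (emb '' ((∑ i, ∏ j, fac gen5 u5 v5 i j).support : Set (Fin 2 →₀ ℕ))))).ncard :=
  length_le_vertices gen5 u5 v5 (by decide) (ss_injective_of_card gen5 (by decide)) certs5
    (by decide) (by decide)

end DecideInstance

/-! ## §G'  (gen 2) The strongest strengthening that survives everything: `#vert ≤ k m t + 2` -/

/-- **Unrefuted strengthening (record, not a claim).**  The sibling crux `DissociatedUniform` with `C = 1`:
on a dissociated frame, `#vert Newt(Σ_{i<k} Π_{j<m} f_ij) ≤ k m t + 2` — "cancellation never beats `k` times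
the Minkowski count `m t`" (KPTT arXiv:1308.2286 §2: `k m t` is the bound WITHOUT cancellation).  Status after
gen 1 + gen 2 + three triage panels + the kinetic probes: NO violation found in any experiment
(`k ≤ 8`, `m ≤ 14`, `t ≤ 4`, torsion / integer / dead-letter designs), and §G shows it would be TIGHT up to
an additive `8` at `k = t = 2` (`4m - 6` attained for every `m ≥ 4`); the `t = 3` two-corner design reaches
`5m - 6 = kmt - m - 6`.  KPTT Example 3 (digit grids, `k = t^{m/3}` monomial products) has exactly `k`
vertices.  A proof even for `k = 2` would contain the kinetic card's near-linear bound; a disproof needs a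
design whose dead zonogon side-vertices each expose MANY flips (the envelope obstruction: flips of
different dead vertices share the generator set, so the total is an envelope complexity, `O(m α(m))` at
`k = 2`).  Filed here so that ideators of stmt-5905 start from the right constant. -/
def DissociatedKMT : Prop :=
  ∀ (k m t : ℕ) (A : Fin m → Finset (Fin 2 →₀ ℕ)) (f : Fin k → Fin m → MvPolynomial (Fin 2) ℂ),
    (∀ j, (A j).card ≤ t) → (∀ i j, (f i j).support ⊆ A j) →
    (∀ a b : Fin m → (Fin 2 →₀ ℕ), (∀ j, a j ∈ A j) → (∀ j, b j ∈ A j) → ∑ j, a j = ∑ j, b j → a = b) →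
    (Set.extremePoints ℝ (convexHull ℝ ((fun e : Fin 2 →₀ ℕ => fun i : Fin 2 => ((e i : ℕ) : ℝ)) ''
      ((∑ i, ∏ j, f i j).support : Set (Fin 2 →₀ ℕ))))).ncard ≤ k * m * t + 2

/-- `DissociatedKMT` is exactly `DissociatedUniform` (stmt-5905) with `C = 1`, hence implies it and the crux. -/
theorem dissociatedUniform_of_KMT (h : DissociatedKMT) :
    Summit.ValiantsHypothesis.ValiantsHypothesis.Theses.NewtonUnitEquations.DissociatedUniform :=
  ⟨1, fun k m t A f h1 h2 h3 => by simpa using h k m t A f h1 h2 h3⟩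

/-- The §G family sits `8` below `DissociatedKMT` at `k = t = 2`: `4m - 6 + 8 = 2 · m · 2 + 2`. -/
theorem family_gap_to_KMT (m : ℕ) (hm : 4 ≤ m) : (4 * m - 6) + 8 = 2 * m * 2 + 2 := by
  omega

end Summit.ValiantsHypothesis.ValiantsHypothesis.Cruxes.DissociatedFixedK.Disproof
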